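/-
Copyright (c) 2026 the pub-hodgecm-mathlib formalisation cell (harness21).  Prover seat hodgecm-mathlib-F0P3a-p08 (g24): line LH3 (closer stub `stub_N9`), LETTER L3′ SURJ-OF-FORWARD,
organ (Σ-WALL) `hwall` — FILTRATION ROAD (W-ROAD CENSUS v1 6129001bfae4ccc0, RULING #26), brick (W3-asm) «THE GENERATOR PACKAGE».
-/
import Literature.NumberTheory.Rogawski1990.ArchBouazizStableFamilyCayleyValue      -- ★ (I₂ at cayPt) product calculus: `stableSum_eq_mul_prod_of_prod`, `archRH_mul_stableSum_eq_mul_prod`, `tendsto_prod_eval_nhdsWithin_regS`, `tendsto_absExpSub_mul_of_eqOn_of_continuousAt`; brings ★ `stOrbFamH`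
import Literature.NumberTheory.Rogawski1990.ArchBouazizStableFamilyCayleyNondeg     -- ★ (N3): `endoTorus_flipSet_snd`
import Literature.NumberTheory.Rogawski1990.ArchBouazizWallClassMultiple            -- ★ (W12-asm) p851576 (LH3-p01 (g6)): `compactRH_ne_zero_of_mem_regS` (the level normaliser `Q` and its kit); brings ★ `bzClassMap`
import Literature.NumberTheory.Rogawski1990.ArchSmooth2AmbientMultiplier            -- ★ (W3-T)/(N1″) p851572 (F0P3a-p09 (g8)): `exists_pos_archSmooth₂_of_blockSupport`, `contDiff_contDiffBump_sum_norm_sq_sub`; brings ★ `ArchSmooth₂`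
import Literature.NumberTheory.Rogawski1990.ArchBouazizWallFrame                    -- ★ (W5-frame) p851588 (LH1-p03 (g7)): `exists_fibrePoint_wall_bricks`, `mem_filter_central_iff`, `mem_filter_not_central_iff`
import Literature.NumberTheory.Rogawski1990.ArchStOrbFamHJumpSideH                 -- ★ (J-H side): `measureReal_univ_archOne_pos`, `compactSpace_archOne`; brings ★ `ArchChartOrbHaarScaling` ((P1) for an ARBITRARY Haar `νH`), (N2) positivity, (P-cont-c/s), `isClosedEmbedding_coe_unitaryGroupOfForm_of_eq_over`, `modularCharacterFun_archLocal_eq_one`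
import Mathlib.Analysis.SpecialFunctions.Trigonometric.DerivHyp
import HarnessLib

/-!
# (W3-asm) THE GENERATOR PACKAGE of Bouaziz's filtration road: one tensor test function per level chart, vanishing on the charts above it and with a non-zero normalised
# limit at the fibre point (Bouaziz 1994 ASENS 27 §4 proof of Thm 4.1.1 pp. 585–586, §5.1 p. 588; Shelstad 1979 §4 Lemma 4.3, Thm. 4.7; Varadarajan 1989 §6.4)

Topic `NumberTheory/Rogawski1990`; namespace `Literature.NumberTheory.Rogawski1990`.  THEOREMS ONLY (no `def`, no instance, no notation, no axiom, no named fact, no `sorry`).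
Cell `pub/hodgecm-mathlib`, crux H413 (`stmt-HodgeConjecture-24833`), line LH3 (closer stub `stub_N9`, DIRECT ROAD), letter L3′ SURJ-OF-FORWARD, organ (Σ-WALL) = the `hwall`
binder of ★ `bouazizSurjOfForward_of_reg_wall`; W-ROAD (FILTRATION ROAD, W-ROAD CENSUS v1 6129001bfae4ccc0, RULING #26), brick **(W3-asm) «THE GENERATOR PACKAGE»** = the `hGen`
hypothesis of ★ (W4) `bzLocalSurjWall_of_parts` (p851574) ∕ ★ `bzLocalSurjWall_of_bricks` (p851580) (LH3-p01 (g6)).  Author F0P3a-p08 (g24).  Lane `--kind proof --supports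
stmt-HodgeConjecture-24833`.  Count-neutral.

THE MATHEMATICS.  A wall base class `b` is the class of a chart point `cb` of its most compact chart `S₀` which is CENTRAL (`e^{iθ₀} = e^{iθ₂}`, block `z_w·1`) at the places `Z` and
regular elsewhere; the charts near `b` are `S₀ ∪ T`, `T ⊆ Z`.  For the level chart `S₀ ∪ T` the GENERATOR `g_T ∈ C_c^∞(H_∞)` is the PURE TENSOR (★ (W3-T)/(N1″)
`exists_pos_archSmooth₂_of_blockSupport`: every smooth function of the place blocks supported blockwise near the centre is `ArchSmooth₂`) whose local factor at `w ∈ Z ∖ T` is the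
COMPACT-TYPE rank-one generator `f^cp_w` of (W3-G) (its split readings `chartOrbHLoc (S ∋ w) f^cp_w` VANISH for `0 < |x_w| < δ` near the centre phase; its two-sided compact reading
`chartOrbHLoc (S ∌ w) f^cp_w (v) + (flip)` has a NON-ZERO joint limit at the centre), at `w ∈ T` the SPLIT-TYPE generator `f^sp_w` (normalised split reading `= G(x, θ)`, `G(0, θ₀) ≠ 0`),
and at the regular places (and on `U(Φ₁)_∞`) a positive bump at the block of `cb`.  Then:
* (G1) on a chart `S₀ ∪ T′`, `T′ ⊆ Z`, `T′ ⊄ T`, a place `w ∈ T′ ∖ T` is SPLIT and carries `f^cp_w`; a regular point `c` whose class is `ε`-close to `b` has `|x_w| < δ`, `e^{iθ_w}` `δ`-close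
  to `z_w` (§2), so the `w`-factor of ★ (P1) `chartOrbH = Λ·ν_B(B)·g·∏_w chartOrbHLoc` vanishes at EVERY flip (flips move compact coordinates only) and `stOrbFamH g_T (S₀ ∪ T′) c = 0`
  (§1 `archRH_mul_stableSum_eq_zero_of_split_eq_zero`, §3 `stOrbFamH_eq_zero_of_chartOrbHLoc_eq_zero`);
* (G3) at the fibre point `c₀` of `S₀ ∪ T` (`x_w = 0`, phase `θ_w` at `w ∈ T`; `cb` elsewhere; class `b`, in the closure of the regular set — §2) the quotient
  `stOrbFamH g_T (S₀ ∪ T) c ∕ Q T c`, `Q T c = ∏_{w ∉ S₀ ∪ T} (1 − e^{i(c_{w,2} − c_{w,0})})` the compact part of `R_{S₀ ∪ T}`, is on the regular set the product `G c · ∏_w L′_w(c w)` of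
  UN-normalised local factors (§1 `archRH_mul_stableSum_div_compactPart_eq_mul_prod`: split `|eˣ−e⁻ˣ|·φ_w`, compact `φ_w + φ_w∘flip`), whose limit along `𝓝[RegS] c₀` is the product of
  the per-place limits (§1 `tendsto_…`, §3 `tendsto_stOrbFamH_div_compactPart_of_prod`): `G(0, θ_w) ≠ 0` at `w ∈ T`, the compact-type limit `ℓ_w ≠ 0` at `w ∈ Z ∖ T`, positive
  values at the regular places (★ (N2) `chartOrbHLoc_ofReal_…`, ★ (P-cont-s/c)), `Λ = haarScalarFactor > 0`, `ν_B(B) > 0`, bump `= 1` at the centre — so `v ≠ 0`.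
The frame's arbitrary Haar `νH` on `H_∞` with its arbitrary Borel structure is docked to the product convention by `BorelSpace.measurable_eq` + `Prod.borelSpace` (as ★
`stOrbFamH_jumpSide_std`) and ★ `chartOrbH_eq_haarScalarFactor_mul_prod_chartOrbHLoc`.

WHAT IS PROVED.
* §1 (group-free) `archRH_eq_splitPart_mul_compactPart`, `archRH_mul_stableSum_div_compactPart_eq_mul_prod`, `tendsto_archRH_mul_stableSum_div_compactPart_of_prod`,
  `archRH_mul_stableSum_eq_zero_of_split_eq_zero` (over ★ `stableSum_eq_mul_prod_of_prod`, ★ `tendsto_prod_eval_nhdsWithin_regS`, ★ `compactRH_ne_zero_of_mem_regS`).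
* §2 (group-free) `exists_forall_abs_lt_and_dist_circleExp_lt_of_dist_bzClassMap_lt` («∀ δ ∃ ε»: class `ε`-close to a central class on a split chart ⇒ `|x| < δ`, phase `δ`-close;
  `cosh x < cosh δ`), `bzClassMap_union_levelPt`, `circleExp_add_ne_circleExp_sub(_of_eq)`, `levelPt_mem_closure_regS` (the diagonal curve off the walls).
* §3 (docking, product test functions, arbitrary Haar `νH`) `chartOrbH_prod_shape`, **`stOrbFamH_eq_zero_of_chartOrbHLoc_eq_zero`**, **`tendsto_stOrbFamH_div_compactPart_of_prod`**.
* §4 `coe_endoBlockAt_of_not_mem_of_eq` (central block `= e^{iθ}·1`), `endoBlockAt_eq_of_mem_iff`, `exists_pos_le_forall_mem_finset`,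
  **`wallGenerators_of_parts (hGsp) (hGcp) (S₀ Z) (hZ) (cb) (hsp) (hcp) (hcen) (b) (hb)`** = `hGen` of ★ `bzLocalSurjWall_of_parts` TOKEN FOR TOKEN with
  `Q T c := ∏ w, if w ∈ S₀ ∪ T then 1 else (1 − e^{i(c w 2 − c w 0)})`, and **`wallGenerators_bricks_of_parts (hGsp) (hGcp)`** = `hGen` of ★ `bzLocalSurjWall_of_bricks` TOKEN FOR TOKEN
  (reference chart point from ★ (F2) `exists_fibrePoint_wall_bricks` at `T = ∅`).
INPUTS BY STATEMENT (ED. 1): the rank-one generator facts (W3-G) of LH3-p02 (g5) with the frame binders quantified — `hGsp` = head (2) «split-type generator at a central block»,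
`hGcp` = head (3) ⊕ (G3-w-cor) «compact-type generator: vanishing split readings near the wall, two-sided compact reading with a non-zero limit at the centre».  ED. 2 discharges them
by name once ★.
HONEST LABEL: L3′ = «S-road organ-complete modulo (Σ-WALL)» until the W-bricks are ★ ((W3-asm) is ★ modulo (W3-G)); HC_CM is proved only modulo the 7 printed citations
(2 remaining: hLiu418 = `stmt-HodgeConjecture-24832`, h413 = `stmt-HodgeConjecture-24833`) until rung 0 closes; this file moves no row of the books.

## References
* [Bouaziz1994IntegralesOrbitales] A. Bouaziz, *Intégrales orbitales sur les groupes de Lie réductifs*, Ann. Sci. ÉNS (4) 27 (1994) 573–609, §2.3 p. 578, §3.1 (I₂) p. 579, §3.2 p. 580,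
  §4 Thm 4.1.1 and its proof pp. 585–586 (filtration by split rank), §5.1 p. 588, Thm. 6.2.1 (i) p. 592.
* [Shelstad1979] D. Shelstad, *Characters and inner forms of a quasi-split group over ℝ*, Compositio Math. 39 (1979) 11–45, §4 pp. 22–25 (`R_T`, flips, Lemma 4.3), Thm. 4.7 p. 31.
* [Varadarajan1989] V. S. Varadarajan, *An Introduction to Harmonic Analysis on Semisimple Lie Groups*, Cambridge Stud. Adv. Math. 16 (1989), §6.4 Thm 22, Thm 23.
* [Rogawski1990] J. D. Rogawski, *Automorphic Representations of Unitary Groups in Three Variables*, Ann. of Math. Stud. 123 (1990), §3.6 p. 31, §4.1 (4.1.1) p. 39, §8.2 pp. 118–122.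
* [BorelJacquet1979] A. Borel, H. Jacquet, *Automorphic forms and automorphic representations*, PSPM 33.1 (1979), §4.1.
-/

set_option autoImplicit false

noncomputable section

open Filter Topology MeasureTheory MeasureTheory.Measure NumberField NumberField.InfinitePlace Complex Set Function Real
open Literature.NumberTheory.Automorphic Literature.NumberTheory.Automorphic.UnitaryGroup Literature.NumberTheory.Automorphic.ArchCartan
open scoped MatrixGroups Matrix NNReal ContDiff Matrix.Norms.Operator

namespace Literature.NumberTheory.Rogawski1990

/-! ## §1 Product calculus for the quotient by the compact part of `R_S` (group-free) -/

section ProductCalculus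

variable {W : Type*} [Fintype W] [DecidableEq W]

/-- `archRH S c` = (split part) · (compact part). [cite: Shelstad1979, §4 p. 22] -/
theorem archRH_eq_splitPart_mul_compactPart (S : Finset W) (c : W → Fin 3 → ℝ) :
    archRH S c = (∏ w, if w ∈ S then (((|Real.exp (c w 0) - Real.exp (-c w 0)| : ℝ) : ℂ)) else 1) *
      ∏ w, if w ∈ S then (1 : ℂ) else (1 - (Circle.exp (c w 2 - c w 0) : ℂ)) := by
  unfold archRH
  rw [← Finset.prod_mul_distrib]
  refine Finset.prod_congr rfl fun w _ => ?_
  split_ifs <;> simp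

/-- **`archRH S · stableSum S Φ` DIVIDED BY THE COMPACT PART OF `R_S`, for a product functional**: the local factors are `|e^{x} − e^{−x}| · φ w` at a split place and the UN-normalised
two-term sum `φ w (c w) + φ w (c w)^flip` at a compact place. [cite: Shelstad1979, §4 pp. 22–23] [cite: Bouaziz1994IntegralesOrbitales, §4 p. 585] -/
theorem archRH_mul_stableSum_div_compactPart_eq_mul_prod (S : Finset W) {Φ G : (W → Fin 3 → ℝ) → ℂ} {φ : W → (Fin 3 → ℝ) → ℂ}
    (hΦ : ∀ c ∈ RegS S, Φ c = G c * ∏ w, φ w (c w)) (hG : ∀ T : Finset W, (∀ w ∈ T, w ∉ S) → ∀ c, G (flipSet T c) = G c)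
    {c : W → Fin 3 → ℝ} (hc : c ∈ RegS S) :
    archRH S c * stableSum S Φ c / (∏ w, if w ∈ S then (1 : ℂ) else (1 - (Circle.exp (c w 2 - c w 0) : ℂ))) =
      G c * ∏ w, (if w ∈ S then (((|Real.exp (c w 0) - Real.exp (-c w 0)| : ℝ) : ℂ) * φ w (c w)) else (φ w (c w) + φ w ![c w 2, c w 1, c w 0])) := by
  have hQ := compactRH_ne_zero_of_mem_regS S hc
  rw [div_eq_iff hQ, stableSum_eq_mul_prod_of_prod S hΦ hG hc, archRH_eq_splitPart_mul_compactPart]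
  -- both sides are `G c` times products over the places; compare factor by factor
  have key : (∏ w, if w ∈ S then (((|Real.exp (c w 0) - Real.exp (-c w 0)| : ℝ) : ℂ)) else 1) *
      (∏ w, (if w ∈ S then φ w (c w) else φ w (c w) + φ w ![c w 2, c w 1, c w 0])) =
      ∏ w, (if w ∈ S then (((|Real.exp (c w 0) - Real.exp (-c w 0)| : ℝ) : ℂ) * φ w (c w)) else (φ w (c w) + φ w ![c w 2, c w 1, c w 0])) := by
    rw [← Finset.prod_mul_distrib]
    refine Finset.prod_congr rfl fun w _ => ?_
    split_ifs <;> simp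
  calc (∏ w, if w ∈ S then (((|Real.exp (c w 0) - Real.exp (-c w 0)| : ℝ) : ℂ)) else 1) *
        (∏ w, if w ∈ S then (1 : ℂ) else (1 - (Circle.exp (c w 2 - c w 0) : ℂ))) *
        (G c * ∏ w, (if w ∈ S then φ w (c w) else φ w (c w) + φ w ![c w 2, c w 1, c w 0]))
      = G c * ((∏ w, if w ∈ S then (((|Real.exp (c w 0) - Real.exp (-c w 0)| : ℝ) : ℂ)) else 1) *
          (∏ w, (if w ∈ S then φ w (c w) else φ w (c w) + φ w ![c w 2, c w 1, c w 0]))) *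
        (∏ w, if w ∈ S then (1 : ℂ) else (1 - (Circle.exp (c w 2 - c w 0) : ℂ))) := by ring
    _ = _ := by rw [key]

/-- **THE LIMIT OF THE QUOTIENT ALONG THE REGULAR SET** from per-place limits of the local factors (split: `|e^{x}−e^{−x}|·φ w`; compact: `φ w + φ w ∘ flip`, UN-normalised) — at ANY
base point (regular, on a real wall, or on an imaginary wall). [cite: Shelstad1979, §4 pp. 22–25] [cite: Bouaziz1994IntegralesOrbitales, §4 p. 585] -/
theorem tendsto_archRH_mul_stableSum_div_compactPart_of_prod (S : Finset W) {Φ G : (W → Fin 3 → ℝ) → ℂ} {φ : W → (Fin 3 → ℝ) → ℂ}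
    (hΦ : ∀ c ∈ RegS S, Φ c = G c * ∏ w, φ w (c w)) (hG : ∀ T : Finset W, (∀ w ∈ T, w ∉ S) → ∀ c, G (flipSet T c) = G c)
    (s : W → Fin 3 → ℝ) {g₀ : ℂ} (hGt : Tendsto G (𝓝[RegS S] s) (𝓝 g₀)) {ℓ : W → ℂ}
    (hsplit : ∀ w ∈ S, Tendsto (fun v : Fin 3 → ℝ => (((|Real.exp (v 0) - Real.exp (-v 0)| : ℝ) : ℂ) * φ w v)) (𝓝[{v : Fin 3 → ℝ | v 0 ≠ 0}] (s w)) (𝓝 (ℓ w)))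
    (hcpt : ∀ w, w ∉ S → Tendsto (fun v : Fin 3 → ℝ => φ w v + φ w ![v 2, v 1, v 0]) (𝓝[{v : Fin 3 → ℝ | Circle.exp (v 0) ≠ Circle.exp (v 2)}] (s w)) (𝓝 (ℓ w))) :
    Tendsto (fun c => archRH S c * stableSum S Φ c / (∏ w, if w ∈ S then (1 : ℂ) else (1 - (Circle.exp (c w 2 - c w 0) : ℂ)))) (𝓝[RegS S] s)
      (𝓝 (g₀ * ∏ w, ℓ w)) := by
  have heq : EqOn (fun c => archRH S c * stableSum S Φ c / (∏ w, if w ∈ S then (1 : ℂ) else (1 - (Circle.exp (c w 2 - c w 0) : ℂ))))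
      (fun c => G c * ∏ w, (if w ∈ S then (((|Real.exp (c w 0) - Real.exp (-c w 0)| : ℝ) : ℂ) * φ w (c w))
        else (φ w (c w) + φ w ![c w 2, c w 1, c w 0]))) (RegS S) :=
    fun c hc => archRH_mul_stableSum_div_compactPart_eq_mul_prod S hΦ hG hc
  refine Tendsto.congr' (eventuallyEq_nhdsWithin_of_eqOn heq).symm (hGt.mul ?_)
  refine tendsto_prod_eval_nhdsWithin_regS S s
    (Lf := fun w v => if w ∈ S then (((|Real.exp (v 0) - Real.exp (-v 0)| : ℝ) : ℂ) * φ w v) else (φ w v + φ w ![v 2, v 1, v 0])) fun w => ?_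
  by_cases hw : w ∈ S
  · simp only [if_pos hw]
    exact hsplit w hw
  · simp only [if_neg hw]
    exact hcpt w hw

/-- **ONE VANISHING SPLIT FACTOR KILLS THE NORMALISED STABLE SUM** of a product functional (the flips do not move the split coordinates). [cite: Shelstad1979, §4 p. 23]
[cite: Bouaziz1994IntegralesOrbitales, §4 p. 585] -/
theorem archRH_mul_stableSum_eq_zero_of_split_eq_zero (S : Finset W) {Φ G : (W → Fin 3 → ℝ) → ℂ} {φ : W → (Fin 3 → ℝ) → ℂ}
    (hΦ : ∀ c ∈ RegS S, Φ c = G c * ∏ w, φ w (c w)) (hG : ∀ T : Finset W, (∀ w ∈ T, w ∉ S) → ∀ c, G (flipSet T c) = G c)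
    {c : W → Fin 3 → ℝ} (hc : c ∈ RegS S) {w : W} (hw : w ∈ S) (h0 : φ w (c w) = 0) :
    archRH S c * stableSum S Φ c = 0 := by
  rw [archRH_mul_stableSum_eq_mul_prod S hΦ hG hc]
  refine mul_eq_zero_of_right _ (Finset.prod_eq_zero (Finset.mem_univ w) ?_)
  rw [if_pos hw, h0, mul_zero]

end ProductCalculus

/-! ## §2 The class map near a central block, read on a split chart; the explicit fibre point of a level chart (group-free) -/

section ClassMapCentre

variable {W : Type*} [Fintype W] [DecidableEq W]

/-- **NEAR A CENTRAL CLASS A SPLIT CHART POINT HAS SMALL `|x_w|` AND PHASE NEAR THE CENTRE**: if the class of the compact chart point `cb` is CENTRAL at `w` (`cb w 0 = cb w 2`,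
class `(2e^{iθ₀}, e^{2iθ₀}, ·)`) and the split reading `((eˣ+e⁻ˣ)e^{iθ}, e^{2iθ}, ·)` of `c` at `w ∈ S` is `ε`-close to it, then `|x| < δ` and `dist (e^{iθ}) (e^{iθ₀}) < δ`
(`ε = min δ (2(cosh δ − 1))`, uniform in everything). [cite: Bouaziz1994IntegralesOrbitales, §2.3 p. 578; §4 p. 585] -/
theorem exists_forall_abs_lt_and_dist_circleExp_lt_of_dist_bzClassMap_lt {δ : ℝ} (hδ : 0 < δ) :
    ∃ ε : ℝ, 0 < ε ∧ ∀ (S S₀ : Finset W) (c cb : W → Fin 3 → ℝ) (w : W), w ∈ S → w ∉ S₀ → cb w 0 = cb w 2 →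
      dist (bzClassMap S c) (bzClassMap S₀ cb) < ε → |c w 0| < δ ∧ dist (Circle.exp (c w 2)) (Circle.exp (cb w 0)) < δ := by
  have hcosh : 0 < 2 * (Real.cosh δ - 1) := by
    have : 1 < Real.cosh δ := Real.one_lt_cosh.2 hδ.ne'
    linarith
  refine ⟨min δ (2 * (Real.cosh δ - 1)), lt_min hδ hcosh, fun S S₀ c cb w hw hw₀ hcen hd => ?_⟩
  -- the first class component at `w`
  have hdw : dist (bzClassMap S c w) (bzClassMap S₀ cb w) < min δ (2 * (Real.cosh δ - 1)) := (dist_le_pi_dist _ _ w).trans_lt hd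
  rw [bzClassMap_of_mem hw, bzClassMap_of_not_mem hw₀, ← hcen] at hdw
  have h1 : dist ((((Real.exp (c w 0) + Real.exp (-(c w 0)) : ℝ) : ℂ)) * (Circle.exp (c w 2) : ℂ))
      ((Circle.exp (cb w 0) : ℂ) + (Circle.exp (cb w 0) : ℂ)) < min δ (2 * (Real.cosh δ - 1)) :=
    lt_of_le_of_lt (by rw [Prod.dist_eq]; exact le_max_left _ _) hdw
  rw [dist_eq_norm] at h1
  set C : ℝ := Real.exp (c w 0) + Real.exp (-(c w 0)) with hC
  have hCcosh : C = 2 * Real.cosh (c w 0) := by rw [hC, Real.cosh_eq]; ring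
  have hC1 : 2 ≤ C := by
    have := Real.one_le_cosh (c w 0)
    linarith
  have hz : ‖(Circle.exp (cb w 0) : ℂ)‖ = 1 := Circle.norm_coe _
  have hu : ‖(Circle.exp (c w 2) : ℂ)‖ = 1 := Circle.norm_coe _
  -- `|C − 2| ≤ ‖C e^{iθ} − 2z‖`
  have hn1 : ‖((C : ℂ)) * (Circle.exp (c w 2) : ℂ)‖ = C := by
    rw [norm_mul, Complex.norm_real, Real.norm_eq_abs, abs_of_nonneg (by linarith : (0 : ℝ) ≤ C), hu, mul_one]
  have hn2 : ‖(Circle.exp (cb w 0) : ℂ) + (Circle.exp (cb w 0) : ℂ)‖ = 2 := by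
    rw [← two_mul, norm_mul, hz, mul_one, Complex.norm_two]
  have hnorm : C - 2 < min δ (2 * (Real.cosh δ - 1)) := by
    have h := abs_norm_sub_norm_le ((C : ℂ) * (Circle.exp (c w 2) : ℂ)) ((Circle.exp (cb w 0) : ℂ) + (Circle.exp (cb w 0) : ℂ))
    rw [hn1, hn2] at h
    exact lt_of_le_of_lt (le_abs_self _) (lt_of_le_of_lt h h1)
  refine ⟨?_, ?_⟩
  · -- `cosh x < cosh δ`
    have hlt : Real.cosh (c w 0) < Real.cosh δ := by
      have := hnorm.trans_le (min_le_right _ _)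
      rw [hCcosh] at this
      linarith
    have := Real.cosh_lt_cosh.1 hlt
    rwa [abs_of_pos hδ] at this
  · -- `‖e^{iθ} − z‖ ≤ ‖e^{iθ} − C/2·e^{iθ}‖ + ‖C/2·e^{iθ} − z‖ < (C/2 − 1) + ε/2 ≤ ε ≤ δ`
    have hdC : dist (Circle.exp (c w 2)) (Circle.exp (cb w 0)) = ‖(Circle.exp (c w 2) : ℂ) - (Circle.exp (cb w 0) : ℂ)‖ := by
      rw [← dist_eq_norm]; rfl
    rw [hdC]
    have hA : ‖(Circle.exp (c w 2) : ℂ) - ((C / 2 : ℝ) : ℂ) * (Circle.exp (c w 2) : ℂ)‖ = C / 2 - 1 := by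
      rw [show (Circle.exp (c w 2) : ℂ) - ((C / 2 : ℝ) : ℂ) * (Circle.exp (c w 2) : ℂ) = (((1 - C / 2 : ℝ)) : ℂ) * (Circle.exp (c w 2) : ℂ) by push_cast; ring,
        norm_mul, hu, mul_one, Complex.norm_real, Real.norm_eq_abs, abs_of_nonpos (by linarith)]
      ring
    have hB : ‖((C / 2 : ℝ) : ℂ) * (Circle.exp (c w 2) : ℂ) - (Circle.exp (cb w 0) : ℂ)‖ < min δ (2 * (Real.cosh δ - 1)) / 2 := by
      have h2 : ((C : ℂ)) * (Circle.exp (c w 2) : ℂ) - ((Circle.exp (cb w 0) : ℂ) + (Circle.exp (cb w 0) : ℂ)) =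
          (2 : ℂ) * ((((C / 2 : ℝ) : ℂ) * (Circle.exp (c w 2) : ℂ) - (Circle.exp (cb w 0) : ℂ))) := by push_cast; ring
      rw [h2, norm_mul, Complex.norm_ofNat] at h1
      linarith
    calc ‖(Circle.exp (c w 2) : ℂ) - (Circle.exp (cb w 0) : ℂ)‖
        ≤ ‖(Circle.exp (c w 2) : ℂ) - ((C / 2 : ℝ) : ℂ) * (Circle.exp (c w 2) : ℂ)‖ + ‖((C / 2 : ℝ) : ℂ) * (Circle.exp (c w 2) : ℂ) - (Circle.exp (cb w 0) : ℂ)‖ :=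
          norm_sub_le_norm_sub_add_norm_sub _ _ _
      _ < (C / 2 - 1) + min δ (2 * (Real.cosh δ - 1)) / 2 := by rw [hA]; linarith
      _ ≤ min δ (2 * (Real.cosh δ - 1)) / 2 + min δ (2 * (Real.cosh δ - 1)) / 2 := by linarith
      _ ≤ δ := by linarith [min_le_left δ (2 * (Real.cosh δ - 1))]

omit [Fintype W] in
/-- **THE FIBRE POINT OF THE LEVEL CHART `S₀ ∪ T`**: reading the central compact places `T` of `cb` as split places with `x = 0` and phase `cb w 0` (the iterated Cayley point) does not
change the class data. [cite: Shelstad1979, §4 p. 25] [cite: Bouaziz1994IntegralesOrbitales, §3.2 p. 580] -/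
theorem bzClassMap_union_levelPt (S₀ T : Finset W) (hT : ∀ w ∈ T, w ∉ S₀) (cb : W → Fin 3 → ℝ) (hcen : ∀ w ∈ T, cb w 0 = cb w 2) :
    bzClassMap (S₀ ∪ T) (fun w => if w ∈ T then ![0, cb w 1, cb w 0] else cb w) = bzClassMap S₀ cb := by
  funext w
  by_cases hwT : w ∈ T
  · rw [bzClassMap_of_mem (Finset.mem_union_right S₀ hwT), bzClassMap_of_not_mem (hT w hwT), ← hcen w hwT]
    simp only [if_pos hwT, Matrix.cons_val_zero, Matrix.cons_val_one, Matrix.cons_val_two, Matrix.head_cons, Matrix.tail_cons, neg_zero, Real.exp_zero]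
    refine Prod.ext ?_ (Prod.ext ?_ rfl)
    · push_cast; ring
    · ring
  · have hmem : w ∈ S₀ ∪ T ↔ w ∈ S₀ := by simp [Finset.mem_union, hwT]
    by_cases hw₀ : w ∈ S₀
    · rw [bzClassMap_of_mem (hmem.2 hw₀), bzClassMap_of_mem hw₀]
      simp only [if_neg hwT]
    · rw [bzClassMap_of_not_mem (fun h => hw₀ (hmem.1 h)), bzClassMap_of_not_mem hw₀]
      simp only [if_neg hwT]

omit [Fintype W] [DecidableEq W] in
/-- `e^{i(θ + t)} ≠ e^{i(θ − t)}` for `0 < t < π`. [cite: Rogawski1990, §8.2 p. 118] -/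
theorem circleExp_add_ne_circleExp_sub (θ : ℝ) {t : ℝ} (h0 : 0 < t) (hπ : t < Real.pi) : Circle.exp (θ + t) ≠ Circle.exp (θ - t) := by
  intro h
  obtain ⟨m, hm⟩ := Circle.exp_eq_exp.1 h
  have h2 : t = (m : ℝ) * Real.pi := by linarith
  have hm0 : (0 : ℝ) < m := lt_of_mul_lt_mul_right (by rw [zero_mul, ← h2]; exact h0) Real.pi_pos.le
  have hm1 : (m : ℝ) < 1 := lt_of_mul_lt_mul_right (by rw [one_mul, ← h2]; exact hπ) Real.pi_pos.le
  have hm0' : (0 : ℤ) < m := by exact_mod_cast hm0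
  have hm1' : m < (1 : ℤ) := by exact_mod_cast hm1
  omega

/-- Two equal circle points shifted apart by `±t`, `0 < t < π`, become distinct. [cite: Rogawski1990, §8.2 p. 118] -/
theorem circleExp_add_ne_circleExp_sub_of_eq {a b : ℝ} (hab : Circle.exp a = Circle.exp b) {t : ℝ} (h0 : 0 < t) (hπ : t < Real.pi) :
    Circle.exp (a + t) ≠ Circle.exp (b - t) := by
  intro h
  apply circleExp_add_ne_circleExp_sub a h0 hπ
  rw [h, Circle.exp_sub, Circle.exp_sub, hab]

omit [Fintype W] in
/-- **THE FIBRE POINT LIES IN THE CLOSURE OF THE REGULAR SET** of the level chart: move off the real walls at `T` and off the imaginary walls at the other central places `Z ∖ T`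
along one diagonal curve. [cite: Bouaziz1994IntegralesOrbitales, §3.1 p. 579] [cite: Shelstad1979, §4 p. 25] -/
theorem levelPt_mem_closure_regS (S₀ Z T : Finset W) (hZ : ∀ w ∈ Z, w ∉ S₀) (hT : T ⊆ Z) (cb : W → Fin 3 → ℝ)
    (hsp : ∀ w ∈ S₀, cb w 0 ≠ 0) (hcp : ∀ w, w ∉ S₀ → w ∉ Z → Circle.exp (cb w 0) ≠ Circle.exp (cb w 2))
    (hcen : ∀ w ∈ Z, Circle.exp (cb w 0) = Circle.exp (cb w 2)) :
    (fun w => if w ∈ T then ![0, cb w 1, cb w 0] else cb w) ∈ closure (RegS (S₀ ∪ T)) := by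
  -- the diagonal curve
  set c₀ : W → Fin 3 → ℝ := fun w => if w ∈ T then ![0, cb w 1, cb w 0] else cb w with hc₀
  set d : W → Fin 3 → ℝ := fun w => if w ∈ T then ![1, 0, 0] else if w ∈ Z then ![1, 0, -1] else 0 with hd
  have hcont : Continuous fun t : ℝ => c₀ + t • d := continuous_const.add (continuous_id.smul continuous_const)
  have hlim : Tendsto (fun t : ℝ => c₀ + t • d) (𝓝[>] 0) (𝓝 c₀) := by
    have := hcont.tendsto 0
    rw [zero_smul, add_zero] at this
    exact this.mono_left nhdsWithin_le_nhds
  refine mem_closure_of_tendsto hlim ?_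
  filter_upwards [Ioo_mem_nhdsGT Real.pi_pos] with t ht
  refine ⟨fun w hw => ?_, fun w hw => ?_⟩
  · -- compact places of `S₀ ∪ T`
    have hw₀ : w ∉ S₀ := fun h => hw (Finset.mem_union_left T h)
    have hwT : w ∉ T := fun h => hw (Finset.mem_union_right S₀ h)
    by_cases hwZ : w ∈ Z
    · simp only [hc₀, hd, Pi.add_apply, Pi.smul_apply, if_neg hwT, if_pos hwZ, smul_eq_mul, Matrix.cons_val_zero, Matrix.cons_val_two,
        Matrix.tail_cons, Matrix.head_cons, mul_one, mul_neg, ← sub_eq_add_neg]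
      exact circleExp_add_ne_circleExp_sub_of_eq (hcen w hwZ) ht.1 ht.2
    · simp only [hc₀, hd, Pi.add_apply, Pi.smul_apply, if_neg hwT, if_neg hwZ, smul_zero, Pi.zero_apply, add_zero]
      exact hcp w hw₀ hwZ
  · -- split places of `S₀ ∪ T`
    rcases Finset.mem_union.1 hw with hw₀ | hwT
    · have hwZ : w ∉ Z := fun h => hZ w h hw₀
      have hwT : w ∉ T := fun h => hwZ (hT h)
      simp only [hc₀, hd, Pi.add_apply, Pi.smul_apply, if_neg hwT, if_neg hwZ, smul_zero, Pi.zero_apply, add_zero]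
      exact hsp w hw₀
    · simp only [hc₀, hd, Pi.add_apply, Pi.smul_apply, if_pos hwT, smul_eq_mul, Matrix.cons_val_zero, mul_one, zero_add]
      exact ht.1.ne'

end ClassMapCentre

/-! ## §3 Docking: the stable orbital family of a PRODUCT test function — one vanishing split factor; the limit of the quotient by the compact part -/

section Docking

open scoped Classical

variable (L : Type) [Field L] [NumberField L] [IsCMField L]
  [∀ w : {w : InfinitePlace L // IsComplex w}, MeasurableSpace ↥(archLocal L 2 (Matrix.of fun i j : Fin 2 => if i.val + j.val + 1 = 2 then (1 : L) else 0) w)] [∀ w : {w : InfinitePlace L // IsComplex w}, BorelSpace ↥(archLocal L 2 (Matrix.of fun i j : Fin 2 => if i.val + j.val + 1 = 2 then (1 : L) else 0) w)]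
  [MeasurableSpace ↥(arch (↥(maximalRealSubfield L)) L (IsCMField.complexConj L) 2 (Matrix.of fun i j : Fin 2 => if i.val + j.val + 1 = 2 then (1 : L) else 0))] [BorelSpace ↥(arch (↥(maximalRealSubfield L)) L (IsCMField.complexConj L) 2 (Matrix.of fun i j : Fin 2 => if i.val + j.val + 1 = 2 then (1 : L) else 0))] [MeasurableSpace ↥(arch (↥(maximalRealSubfield L)) L (IsCMField.complexConj L) 1 (Matrix.of fun i j : Fin 1 => if i.val + j.val + 1 = 1 then (1 : L) else 0))] [BorelSpace ↥(arch (↥(maximalRealSubfield L)) L (IsCMField.complexConj L) 1 (Matrix.of fun i j : Fin 1 => if i.val + j.val + 1 = 1 then (1 : L) else 0))]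
  (νw : ∀ w : {w : InfinitePlace L // IsComplex w}, Measure ↥(archLocal L 2 (Matrix.of fun i j : Fin 2 => if i.val + j.val + 1 = 2 then (1 : L) else 0) w)) [∀ w, (νw w).IsHaarMeasure] [∀ w, (νw w).IsMulRightInvariant]
  (νB : Measure ↥(arch (↥(maximalRealSubfield L)) L (IsCMField.complexConj L) 1 (Matrix.of fun i j : Fin 1 => if i.val + j.val + 1 = 1 then (1 : L) else 0))) [νB.IsHaarMeasure] [νB.IsMulRightInvariant]
  (νH : Measure (↥(arch (↥(maximalRealSubfield L)) L (IsCMField.complexConj L) 2 (Matrix.of fun i j : Fin 2 => if i.val + j.val + 1 = 2 then (1 : L) else 0)) × ↥(arch (↥(maximalRealSubfield L)) L (IsCMField.complexConj L) 1 (Matrix.of fun i j : Fin 1 => if i.val + j.val + 1 = 1 then (1 : L) else 0)))) [νH.IsHaarMeasure] [νH.IsMulRightInvariant]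

/-- The product reading (P1) of the chart orbital functional, for an arbitrary Haar measure, in the `G c · ∏_w φ w (c w)` shape of the product calculus.
[cite: BorelJacquet1979, §4.1] [cite: Rogawski1990, §8.2 p. 122] -/
theorem chartOrbH_prod_shape
    (fH : (↥(arch (↥(maximalRealSubfield L)) L (IsCMField.complexConj L) 2 (Matrix.of fun i j : Fin 2 => if i.val + j.val + 1 = 2 then (1 : L) else 0)) × ↥(arch (↥(maximalRealSubfield L)) L (IsCMField.complexConj L) 1 (Matrix.of fun i j : Fin 1 => if i.val + j.val + 1 = 1 then (1 : L) else 0))) → ℂ) (f : ∀ w : {w : InfinitePlace L // IsComplex w}, ↥(archLocal L 2 (Matrix.of fun i j : Fin 2 => if i.val + j.val + 1 = 2 then (1 : L) else 0) w) → ℂ) (g : ↥(arch (↥(maximalRealSubfield L)) L (IsCMField.complexConj L) 1 (Matrix.of fun i j : Fin 1 => if i.val + j.val + 1 = 1 then (1 : L) else 0)) → ℂ) (hfH : ∀ a b, fH (a, b) = (∏ w, f w (archPiEquivCM 2 L (Matrix.of fun i j : Fin 2 => if i.val + j.val + 1 = 2 then (1 : L) else 0) a w)) * g b)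
    (S : Finset {w : InfinitePlace L // IsComplex w}) (c : {w : InfinitePlace L // IsComplex w} → Fin 3 → ℝ) :
    haveI := isHaarMeasure_prodConventionH L νw νB
    chartOrbH L νH S fH c =
      (((haarScalarFactor νH (((Measure.pi νw).map (archPiEquivCM 2 L (Matrix.of fun i j : Fin 2 => if i.val + j.val + 1 = 2 then (1 : L) else 0)).symm).prod νB) : ℝ) : ℂ) * ((νB.real Set.univ : ℂ) * g (endoTorus L S c).2)) *
        ∏ w, chartOrbHLoc L S w (νw w) (f w) (c w) := by
  rw [chartOrbH_eq_haarScalarFactor_mul_prod_chartOrbHLoc L νw νB S νH fH f g hfH c]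
  ring

/-- **(G1)-DOCKING: ONE VANISHING SPLIT LOCAL FUNCTIONAL KILLS THE STABLE ORBITAL FAMILY OF A PRODUCT TEST FUNCTION** at a regular point (any Haar `νH`: ★ (P1) for an arbitrary
Haar measure, then §1). [cite: Bouaziz1994IntegralesOrbitales, §4 p. 585] [cite: Shelstad1979, §4 p. 23] -/
theorem stOrbFamH_eq_zero_of_chartOrbHLoc_eq_zero
    (fH : (↥(arch (↥(maximalRealSubfield L)) L (IsCMField.complexConj L) 2 (Matrix.of fun i j : Fin 2 => if i.val + j.val + 1 = 2 then (1 : L) else 0)) × ↥(arch (↥(maximalRealSubfield L)) L (IsCMField.complexConj L) 1 (Matrix.of fun i j : Fin 1 => if i.val + j.val + 1 = 1 then (1 : L) else 0))) → ℂ) (f : ∀ w : {w : InfinitePlace L // IsComplex w}, ↥(archLocal L 2 (Matrix.of fun i j : Fin 2 => if i.val + j.val + 1 = 2 then (1 : L) else 0) w) → ℂ) (g : ↥(arch (↥(maximalRealSubfield L)) L (IsCMField.complexConj L) 1 (Matrix.of fun i j : Fin 1 => if i.val + j.val + 1 = 1 then (1 : L) else 0)) → ℂ) (hfH : ∀ a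 b, fH (a, b) = (∏ w, f w (archPiEquivCM 2 L (Matrix.of fun i j : Fin 2 => if i.val + j.val + 1 = 2 then (1 : L) else 0) a w)) * g b)
    (S : Finset {w : InfinitePlace L // IsComplex w}) {c : {w : InfinitePlace L // IsComplex w} → Fin 3 → ℝ} (hc : c ∈ RegS S) {w : {w : InfinitePlace L // IsComplex w}} (hw : w ∈ S) (h0 : chartOrbHLoc L S w (νw w) (f w) (c w) = 0) :
    stOrbFamH L νH fH S c = 0 := by
  -- a reference Haar measure on the compact abelian `U(Φ₁)_∞` (right invariant because the group is commutative)
  let νB : Measure ↥(arch (↥(maximalRealSubfield L)) L (IsCMField.complexConj L) 1 (Matrix.of fun i j : Fin 1 => if i.val + j.val + 1 = 1 then (1 : L) else 0)) := Measure.haar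
  haveI : νB.IsMulRightInvariant := by
    letI : CommGroup ↥(arch (↥(maximalRealSubfield L)) L (IsCMField.complexConj L) 1 (Matrix.of fun i j : Fin 1 => if i.val + j.val + 1 = 1 then (1 : L) else 0)) := { (inferInstance : Group ↥(arch (↥(maximalRealSubfield L)) L (IsCMField.complexConj L) 1 (Matrix.of fun i j : Fin 1 => if i.val + j.val + 1 = 1 then (1 : L) else 0))) with mul_comm := archOne_mul_comm L }
    infer_instance
  haveI := isHaarMeasure_prodConventionH L νw νB
  rw [stOrbFamH_def, bzExtend_of_mem_regS S _ hc]
  exact archRH_mul_stableSum_eq_zero_of_split_eq_zero S (Φ := chartOrbH L νH S fH)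
    (φ := fun w v => chartOrbHLoc L S w (νw w) (f w) v) (fun c _ => chartOrbH_prod_shape L νw νB νH fH f g hfH S c)
    (fun T _ c => by simp only [endoTorus_flipSet_snd]) hc hw h0

/-- **(G3)-DOCKING: THE LIMIT OF `stOrbFamH ∕ (compact part of R_S)` FOR A PRODUCT TEST FUNCTION** at any base point `s`, from per-place limits of the local factors (split:
`|e^{x}−e^{−x}| · chartOrbHLoc`; compact: `chartOrbHLoc + chartOrbHLoc ∘ flip`) and continuity of `g`; the limit is `Λ · ν_B(B) · g((endoTorus S s).2) · ∏_w ℓ w`,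
`Λ = haarScalarFactor νH ν₀ > 0`. [cite: Bouaziz1994IntegralesOrbitales, §3.1 (I₂) p. 579; §4 p. 585] [cite: Shelstad1979, §4 pp. 22–25] -/
theorem tendsto_stOrbFamH_div_compactPart_of_prod
    (fH : (↥(arch (↥(maximalRealSubfield L)) L (IsCMField.complexConj L) 2 (Matrix.of fun i j : Fin 2 => if i.val + j.val + 1 = 2 then (1 : L) else 0)) × ↥(arch (↥(maximalRealSubfield L)) L (IsCMField.complexConj L) 1 (Matrix.of fun i j : Fin 1 => if i.val + j.val + 1 = 1 then (1 : L) else 0))) → ℂ) (f : ∀ w : {w : InfinitePlace L // IsComplex w}, ↥(archLocal L 2 (Matrix.of fun i j : Fin 2 => if i.val + j.val + 1 = 2 then (1 : L) else 0) w) → ℂ) (g : ↥(arch (↥(maximalRealSubfield L)) L (IsCMField.complexConj L) 1 (Matrix.of fun i j : Fin 1 => if i.val + j.val + 1 = 1 then (1 : L) else 0)) → ℂ) (hfH : ∀ a b, fH (a, b) = (∏ w, f w (archPiEquivCM 2 L (Matrix.of fun i j : Fin 2 => if i.val + j.val + 1 = 2 then (1 : L) else 0) a w)) * g b) (hg : Continuous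 g)
    (S : Finset {w : InfinitePlace L // IsComplex w}) (s : {w : InfinitePlace L // IsComplex w} → Fin 3 → ℝ) {ℓ : {w : InfinitePlace L // IsComplex w} → ℂ}
    (hsplit : ∀ w ∈ S, Tendsto (fun v : Fin 3 → ℝ => (((|Real.exp (v 0) - Real.exp (-v 0)| : ℝ) : ℂ) * chartOrbHLoc L S w (νw w) (f w) v))
      (𝓝[{v : Fin 3 → ℝ | v 0 ≠ 0}] (s w)) (𝓝 (ℓ w)))
    (hcpt : ∀ w, w ∉ S → Tendsto (fun v : Fin 3 → ℝ => chartOrbHLoc L S w (νw w) (f w) v + chartOrbHLoc L S w (νw w) (f w) ![v 2, v 1, v 0])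
      (𝓝[{v : Fin 3 → ℝ | Circle.exp (v 0) ≠ Circle.exp (v 2)}] (s w)) (𝓝 (ℓ w))) :
    haveI := isHaarMeasure_prodConventionH L νw νB
    Tendsto (fun c => stOrbFamH L νH fH S c / (∏ w, if w ∈ S then (1 : ℂ) else (1 - (Circle.exp (c w 2 - c w 0) : ℂ)))) (𝓝[RegS S] s)
      (𝓝 (((haarScalarFactor νH (((Measure.pi νw).map (archPiEquivCM 2 L (Matrix.of fun i j : Fin 2 => if i.val + j.val + 1 = 2 then (1 : L) else 0)).symm).prod νB) : ℝ) : ℂ) * ((νB.real Set.univ : ℂ) * g (endoTorus L S s).2) * ∏ w, ℓ w)) := by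
  haveI := isHaarMeasure_prodConventionH L νw νB
  have heq : EqOn (fun c => stOrbFamH L νH fH S c / (∏ w, if w ∈ S then (1 : ℂ) else (1 - (Circle.exp (c w 2 - c w 0) : ℂ))))
      (fun c => archRH S c * stableSum S (chartOrbH L νH S fH) c / (∏ w, if w ∈ S then (1 : ℂ) else (1 - (Circle.exp (c w 2 - c w 0) : ℂ)))) (RegS S) := by
    intro c hc
    simp only [stOrbFamH_def, bzExtend_of_mem_regS S _ hc]
  refine Tendsto.congr' (eventuallyEq_nhdsWithin_of_eqOn heq).symm ?_
  have hGc : Continuous fun c : {w : InfinitePlace L // IsComplex w} → Fin 3 → ℝ =>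
      (((haarScalarFactor νH (((Measure.pi νw).map (archPiEquivCM 2 L (Matrix.of fun i j : Fin 2 => if i.val + j.val + 1 = 2 then (1 : L) else 0)).symm).prod νB) : ℝ) : ℂ) * ((νB.real Set.univ : ℂ) * g (endoTorus L S c).2)) :=
    continuous_const.mul (continuous_const.mul (hg.comp (continuous_snd.comp (continuous_endoTorus L S))))
  exact tendsto_archRH_mul_stableSum_div_compactPart_of_prod S (Φ := chartOrbH L νH S fH)
    (φ := fun w v => chartOrbHLoc L S w (νw w) (f w) v) (fun c _ => chartOrbH_prod_shape L νw νB νH fH f g hfH S c)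
    (fun T _ c => by simp only [endoTorus_flipSet_snd]) s hGc.continuousAt.continuousWithinAt.tendsto hsplit hcpt

end Docking

/-! ## §4 THE GENERATOR PACKAGE (W3-asm): `hGen` of (W4) from the rank-one generator facts (W3-G) and the tensor test functions (W3-T)/(N1″) -/

section Generators

open scoped Classical

/-- At a compact place with equal angles the chart block is the CENTRAL element `e^{iθ}·1`. [cite: Rogawski1990, §8.2 p. 122] -/
theorem coe_endoBlockAt_of_not_mem_of_eq (L : Type) [Field L] (S : Finset {w : InfinitePlace L // IsComplex w}) (w : {w : InfinitePlace L // IsComplex w}) (hw : w ∉ S) {cw : Fin 3 → ℝ} (h : cw 0 = cw 2) :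
    (((endoBlockAt L S w cw : ↥(archLocal L 2 (Matrix.of fun i j : Fin 2 => if i.val + j.val + 1 = 2 then (1 : L) else 0) w)) : GL (Fin 2) ℂ) : Matrix (Fin 2) (Fin 2) ℂ) = ((Circle.exp (cw 0) : ℂ)) • (1 : Matrix (Fin 2) (Fin 2) ℂ) := by
  rw [endoBlockAt_eq_endoBlock, coe_endoBlock_of_not_mem L (fun _ => cw) hw, ← h]
  ext i j
  fin_cases i <;> fin_cases j <;> simp

/-- The local chart block depends on the label only through `w ∈ S`. [cite: Rogawski1990, §8.2 p. 122] -/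
theorem endoBlockAt_eq_of_mem_iff (L : Type) [Field L] {S S' : Finset {w : InfinitePlace L // IsComplex w}} {w : {w : InfinitePlace L // IsComplex w}} (h : w ∈ S ↔ w ∈ S') (cw : Fin 3 → ℝ) :
    endoBlockAt L S w cw = endoBlockAt L S' w cw := by
  unfold endoBlockAt endoBlock
  by_cases hw : w ∈ S
  · rw [if_pos hw, if_pos (h.1 hw)]
  · rw [if_neg hw, if_neg (fun h' => hw (h.2 h'))]

/-- A positive number below a positive number attached to each member of a finite set. [cite: Bouaziz1994IntegralesOrbitales, §4 p. 585] -/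
theorem exists_pos_le_forall_mem_finset {ι : Type*} (s : Finset ι) {δ : ι → ℝ} (hδ : ∀ i ∈ s, 0 < δ i) : ∃ ε : ℝ, 0 < ε ∧ ∀ i ∈ s, ε ≤ δ i := by
  classical
  induction s using Finset.induction_on with
  | empty => exact ⟨1, one_pos, fun i hi => absurd hi (Finset.notMem_empty i)⟩
  | insert a s ha ih =>
    obtain ⟨ε, hε, hεs⟩ := ih fun i hi => hδ i (Finset.mem_insert_of_mem hi)
    refine ⟨min ε (δ a), lt_min hε (hδ a (Finset.mem_insert_self a s)), fun i hi => ?_⟩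
    rcases Finset.mem_insert.1 hi with rfl | hi
    · exact min_le_right _ _
    · exact (min_le_left _ _).trans (hεs i hi)

variable (L : Type) [Field L] [NumberField L] [IsCMField L]

/-- **(W3-asm) THE GENERATOR PACKAGE OF THE FILTRATION ROAD** — the `hGen` organ of ★ `bzLocalSurjWall_of_parts` (p851574) TOKEN FOR TOKEN, for the base class `b = bzClassMap S₀ cb`
of a chart point `cb` of the most compact chart `S₀` that is split-regular on `S₀`, compact-regular off `S₀ ∪ Z` and CENTRAL on `Z` (`cb w 0 = cb w 2`), and the level normaliser
`Q T c = ∏ w, if w ∈ S₀ ∪ T then 1 else (1 − e^{i(c w 2 − c w 0)})` (the compact part of ★ `archRH`; ★ `compactRH_…` kit).  For `T ⊆ Z` the generator is the TENSOR test function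
whose local factor is the compact-type rank-one generator `f^cp_w` at `w ∈ Z ∖ T` (its split readings vanish near the wall: (G1); its two-sided compact reading has a non-zero limit
at the centre: (G3)), the split-type generator `f^sp_w` at `w ∈ T` (non-zero cone value), and a positive bump at the regular block of `cb` elsewhere and on `U(Φ₁)_∞`
(★ (W3-T)/(N1″) `exists_pos_archSmooth₂_of_blockSupport`); (G1) is ONE vanishing split factor read through ★ (P1) (`stOrbFamH_eq_zero_of_chartOrbHLoc_eq_zero`), (G3) is the product
of the per-place limits (`tendsto_stOrbFamH_div_compactPart_of_prod`) at the explicit fibre point `c₀ w = if w ∈ T then (0, cb w 1, cb w 0) else cb w`.  INPUTS BY STATEMENT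
(ED. 1): `hGsp` = (W3-G) split-type generator (LH3-p02 (g5) head (2)), `hGcp` = (W3-G) compact-type generator with its two-sided compact reading at the centre (head (3) ⊕
(G3-w-cor)), frame binders quantified. [cite: Bouaziz1994IntegralesOrbitales, §4 proof of Thm 4.1.1 pp. 585–586; §5.1 p. 588] [cite: Shelstad1979, §4 Lemma 4.3 p. 25, Thm. 4.7 p. 31]
[cite: Varadarajan1989, §6.4 Thm 22, Thm 23] -/
theorem wallGenerators_of_parts
    [iH : MeasurableSpace (↥(arch (↥(maximalRealSubfield L)) L (IsCMField.complexConj L) 2 (Matrix.of fun i j : Fin 2 => if i.val + j.val + 1 = 2 then (1 : L) else 0)) × ↥(arch (↥(maximalRealSubfield L)) L (IsCMField.complexConj L) 1 (Matrix.of fun i j : Fin 1 => if i.val + j.val + 1 = 1 then (1 : L) else 0)))] [iHB : BorelSpace (↥(arch (↥(maximalRealSubfield L)) L (IsCMField.complexConj L) 2 (Matrix.of fun i j : Fin 2 => if i.val + j.val + 1 = 2 then (1 : L) else 0)) × ↥(arch (↥(maximalRealSubfield L)) L (IsCMField.complexConj L) 1 (Matrix.of fun i j : Fin 1 => if i.val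 + j.val + 1 = 1 then (1 : L) else 0)))] (νH : Measure (↥(arch (↥(maximalRealSubfield L)) L (IsCMField.complexConj L) 2 (Matrix.of fun i j : Fin 2 => if i.val + j.val + 1 = 2 then (1 : L) else 0)) × ↥(arch (↥(maximalRealSubfield L)) L (IsCMField.complexConj L) 1 (Matrix.of fun i j : Fin 1 => if i.val + j.val + 1 = 1 then (1 : L) else 0)))) [νH.IsHaarMeasure] [νH.IsMulRightInvariant]
    -- (W3-G) split-type generator at a central block (LH3-p02 (g5) head (2), frame binders quantified)
    (hGsp : ∀ (w : {w : InfinitePlace L // IsComplex w}) [MeasurableSpace ↥(archLocal L 2 (Matrix.of fun i j : Fin 2 => if i.val + j.val + 1 = 2 then (1 : L) else 0) w)] [BorelSpace ↥(archLocal L 2 (Matrix.of fun i j : Fin 2 => if i.val + j.val + 1 = 2 then (1 : L) else 0) w)] (νw : Measure ↥(archLocal L 2 (Matrix.of fun i j : Fin 2 => if i.val + j.val + 1 = 2 then (1 : L) else 0) w)) [νw.IsHaarMeasure] [νw.IsMulRightInvariant]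
      (θ₀ : ℝ) (U : Set (Matrix (Fin 2) (Fin 2) ℂ)), U ∈ 𝓝 ((((Circle.exp θ₀ : Circle) : ℂ)) • (1 : Matrix (Fin 2) (Fin 2) ℂ)) →
      ∃ (f₀ : Matrix (Fin 2) (Fin 2) ℂ → ℂ) (G : ℝ × ℝ → ℂ), ContDiff ℝ ∞ f₀ ∧ HasCompactSupport f₀ ∧ tsupport f₀ ⊆ U ∧ (∀ X, 0 ≤ (f₀ X).re ∧ (f₀ X).im = 0) ∧
        f₀ ((((Circle.exp θ₀ : Circle) : ℂ)) • 1) = 1 ∧ ContDiff ℝ ∞ G ∧ (∀ x θ, G (-x, θ) = G (x, θ)) ∧ G (0, θ₀) ≠ 0 ∧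
        ∀ S : Finset {w : InfinitePlace L // IsComplex w}, w ∈ S → ∀ cw : Fin 3 → ℝ, cw 0 ≠ 0 →
          (((|Real.exp (cw 0) - Real.exp (-(cw 0))| : ℝ) : ℂ) * chartOrbHLoc L S w νw (fun g => f₀ ((g : GL (Fin 2) ℂ) : Matrix (Fin 2) (Fin 2) ℂ)) cw) = G (cw 0, cw 2))
    -- (W3-G) compact-type generator at a central block: (G1-w) vanishing split readings near the wall, (G3-w-cor) two-sided compact reading with a non-zero limit at the centre
    (hGcp : ∀ (w : {w : InfinitePlace L // IsComplex w}) [MeasurableSpace ↥(archLocal L 2 (Matrix.of fun i j : Fin 2 => if i.val + j.val + 1 = 2 then (1 : L) else 0) w)] [BorelSpace ↥(archLocal L 2 (Matrix.of fun i j : Fin 2 => if i.val + j.val + 1 = 2 then (1 : L) else 0) w)] (νw : Measure ↥(archLocal L 2 (Matrix.of fun i j : Fin 2 => if i.val + j.val + 1 = 2 then (1 : L) else 0) w)) [νw.IsHaarMeasure] [νw.IsMulRightInvariant]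
      (θ₀ : ℝ) (U : Set (Matrix (Fin 2) (Fin 2) ℂ)), U ∈ 𝓝 ((((Circle.exp θ₀ : Circle) : ℂ)) • (1 : Matrix (Fin 2) (Fin 2) ℂ)) →
      ∃ (f₀ : Matrix (Fin 2) (Fin 2) ℂ → ℂ) (δ : ℝ) (ℓ : ℂ), ContDiff ℝ ∞ f₀ ∧ HasCompactSupport f₀ ∧ tsupport f₀ ⊆ U ∧ 0 < δ ∧ ℓ ≠ 0 ∧
        (∀ S : Finset {w : InfinitePlace L // IsComplex w}, w ∈ S → ∀ cw : Fin 3 → ℝ, cw 0 ≠ 0 → |cw 0| < δ → dist (Circle.exp (cw 2)) (Circle.exp θ₀) < δ →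
          chartOrbHLoc L S w νw (fun g => f₀ ((g : GL (Fin 2) ℂ) : Matrix (Fin 2) (Fin 2) ℂ)) cw = 0) ∧
        (∀ S : Finset {w : InfinitePlace L // IsComplex w}, w ∉ S → ∀ v₀ : Fin 3 → ℝ, Circle.exp (v₀ 0) = Circle.exp θ₀ → Circle.exp (v₀ 2) = Circle.exp θ₀ →
          Tendsto (fun v : Fin 3 → ℝ => chartOrbHLoc L S w νw (fun g => f₀ ((g : GL (Fin 2) ℂ) : Matrix (Fin 2) (Fin 2) ℂ)) v +
              chartOrbHLoc L S w νw (fun g => f₀ ((g : GL (Fin 2) ℂ) : Matrix (Fin 2) (Fin 2) ℂ)) ![v 2, v 1, v 0])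
            (𝓝[{v : Fin 3 → ℝ | Circle.exp (v 0) ≠ Circle.exp (v 2)}] v₀) (𝓝 ℓ)))
    -- the base class through a chart point of the most compact chart
    (S₀ Z : Finset {w : InfinitePlace L // IsComplex w}) (hZ : ∀ w ∈ Z, w ∉ S₀) (cb : {w : InfinitePlace L // IsComplex w} → Fin 3 → ℝ)
    (hsp : ∀ w ∈ S₀, cb w 0 ≠ 0) (hcp : ∀ w, w ∉ S₀ → w ∉ Z → Circle.exp (cb w 0) ≠ Circle.exp (cb w 2)) (hcen : ∀ w ∈ Z, cb w 0 = cb w 2)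
    (b : {w : InfinitePlace L // IsComplex w} → ℂ × ℂ × ℂ) (hb : bzClassMap S₀ cb = b) :
    ∀ T, T ⊆ Z → ∃ g : (↥(arch (↥(maximalRealSubfield L)) L (IsCMField.complexConj L) 2 (Matrix.of fun i j : Fin 2 => if i.val + j.val + 1 = 2 then (1 : L) else 0)) × ↥(arch (↥(maximalRealSubfield L)) L (IsCMField.complexConj L) 1 (Matrix.of fun i j : Fin 1 => if i.val + j.val + 1 = 1 then (1 : L) else 0))) → ℂ, ArchSmooth₂ L g ∧
      (∃ ε : ℝ, 0 < ε ∧ ∀ T', T' ⊆ Z → ¬ T' ⊆ T → ∀ c, c ∈ RegS (S₀ ∪ T') → dist (bzClassMap (S₀ ∪ T') c) b < ε →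
        stOrbFamH L νH g (S₀ ∪ T') c = 0) ∧
      ∃ (c₀ : {w : InfinitePlace L // IsComplex w} → Fin 3 → ℝ) (v : ℂ), bzClassMap (S₀ ∪ T) c₀ = b ∧ c₀ ∈ closure (RegS (S₀ ∪ T)) ∧ v ≠ 0 ∧
        Tendsto (fun c => stOrbFamH L νH g (S₀ ∪ T) c / ∏ w, (if w ∈ S₀ ∪ T then (1 : ℂ) else (1 - (Circle.exp (c w 2 - c w 0) : ℂ))))
          (𝓝[RegS (S₀ ∪ T)] c₀) (𝓝 v) := by
  subst hb
  intro T hT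
  /- 0 · FRAME: the organ's measurable structure on `H_∞` IS the product of the Borel structures of the factors; reference Haar measures `haar` at every place and on
  `U(Φ₁)_∞` (the product convention `ν₀`), `νH = Λ • ν₀`-wise through ★ `chartOrbH_eq_haarScalarFactor_mul_prod_chartOrbHLoc`. -/
  letI iW : ∀ w : {w : InfinitePlace L // IsComplex w}, MeasurableSpace ↥(archLocal L 2 (Matrix.of fun i j : Fin 2 => if i.val + j.val + 1 = 2 then (1 : L) else 0) w) := fun w => borel _
  haveI : ∀ w : {w : InfinitePlace L // IsComplex w}, BorelSpace ↥(archLocal L 2 (Matrix.of fun i j : Fin 2 => if i.val + j.val + 1 = 2 then (1 : L) else 0) w) := fun w => ⟨rfl⟩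
  haveI : ∀ w : {w : InfinitePlace L // IsComplex w}, LocallyCompactSpace ↥(archLocal L 2 (Matrix.of fun i j : Fin 2 => if i.val + j.val + 1 = 2 then (1 : L) else 0) w) := fun w => locallyCompactSpace_archLocal_two L w
  haveI : ∀ w : {w : InfinitePlace L // IsComplex w}, SecondCountableTopology ↥(archLocal L 2 (Matrix.of fun i j : Fin 2 => if i.val + j.val + 1 = 2 then (1 : L) else 0) w) := fun w => secondCountableTopology_archLocal_two L w
  letI iH2 : MeasurableSpace ↥(arch (↥(maximalRealSubfield L)) L (IsCMField.complexConj L) 2 (Matrix.of fun i j : Fin 2 => if i.val + j.val + 1 = 2 then (1 : L) else 0)) := borel _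
  haveI : BorelSpace ↥(arch (↥(maximalRealSubfield L)) L (IsCMField.complexConj L) 2 (Matrix.of fun i j : Fin 2 => if i.val + j.val + 1 = 2 then (1 : L) else 0)) := ⟨rfl⟩
  letI iB : MeasurableSpace ↥(arch (↥(maximalRealSubfield L)) L (IsCMField.complexConj L) 1 (Matrix.of fun i j : Fin 1 => if i.val + j.val + 1 = 1 then (1 : L) else 0)) := borel _
  haveI : BorelSpace ↥(arch (↥(maximalRealSubfield L)) L (IsCMField.complexConj L) 1 (Matrix.of fun i j : Fin 1 => if i.val + j.val + 1 = 1 then (1 : L) else 0)) := ⟨rfl⟩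
  have hiH : iH = @Prod.instMeasurableSpace ↥(arch (↥(maximalRealSubfield L)) L (IsCMField.complexConj L) 2 (Matrix.of fun i j : Fin 2 => if i.val + j.val + 1 = 2 then (1 : L) else 0)) ↥(arch (↥(maximalRealSubfield L)) L (IsCMField.complexConj L) 1 (Matrix.of fun i j : Fin 1 => if i.val + j.val + 1 = 1 then (1 : L) else 0)) (borel _) (borel _) :=
    (@BorelSpace.measurable_eq _ _ iH iHB).trans (@BorelSpace.measurable_eq _ _ (@Prod.instMeasurableSpace ↥(arch (↥(maximalRealSubfield L)) L (IsCMField.complexConj L) 2 (Matrix.of fun i j : Fin 2 => if i.val + j.val + 1 = 2 then (1 : L) else 0)) ↥(arch (↥(maximalRealSubfield L)) L (IsCMField.complexConj L) 1 (Matrix.of fun i j : Fin 1 => if i.val + j.val + 1 = 1 then (1 : L) else 0)) (borel _) (borel _)) Prod.borelSpace).symm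
  subst hiH
  haveI := compactSpace_archOne L
  have hherm : (((Matrix.of fun i j : Fin 2 => if i.val + j.val + 1 = 2 then (1 : L) else 0)).map (cmConjRingHom L))ᵀ = (Matrix.of fun i j : Fin 2 => if i.val + j.val + 1 = 2 then (1 : L) else 0) := by
    rw [← StdForm.over_antidiagonal_eq]; exact cmConj_antidiagonal_transpose L 2
  have hdet : ((Matrix.of fun i j : Fin 2 => if i.val + j.val + 1 = 2 then (1 : L) else 0)).det ≠ 0 := by
    rw [Matrix.det_fin_two]; simp
  let νw : ∀ w : {w : InfinitePlace L // IsComplex w}, Measure ↥(archLocal L 2 (Matrix.of fun i j : Fin 2 => if i.val + j.val + 1 = 2 then (1 : L) else 0) w) := fun w => Measure.haar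
  haveI hνwH : ∀ w, (νw w).IsHaarMeasure := fun w => by simp only [νw]; infer_instance
  haveI : ∀ w, (νw w).IsMulRightInvariant := fun w =>
    isMulRightInvariant_of_modularCharacterFun_eq_one (modularCharacterFun_archLocal_eq_one L (Matrix.of fun i j : Fin 2 => if i.val + j.val + 1 = 2 then (1 : L) else 0) hherm hdet w) (νw w)
  let νB : Measure ↥(arch (↥(maximalRealSubfield L)) L (IsCMField.complexConj L) 1 (Matrix.of fun i j : Fin 1 => if i.val + j.val + 1 = 1 then (1 : L) else 0)) := Measure.haar
  haveI : νB.IsMulRightInvariant := by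
    letI : CommGroup ↥(arch (↥(maximalRealSubfield L)) L (IsCMField.complexConj L) 1 (Matrix.of fun i j : Fin 1 => if i.val + j.val + 1 = 1 then (1 : L) else 0)) := { (inferInstance : Group ↥(arch (↥(maximalRealSubfield L)) L (IsCMField.complexConj L) 1 (Matrix.of fun i j : Fin 1 => if i.val + j.val + 1 = 1 then (1 : L) else 0))) with mul_comm := archOne_mul_comm L }
    infer_instance
  have hB : 0 < νB.real Set.univ := measureReal_univ_archOne_pos L νB
  haveI := isHaarMeasure_prodConventionH L νw νB
  have hΛ : 0 < haarScalarFactor νH (((Measure.pi νw).map (archPiEquivCM 2 L (Matrix.of fun i j : Fin 2 => if i.val + j.val + 1 = 2 then (1 : L) else 0)).symm).prod νB) := haarScalarFactor_pos_of_isHaarMeasure _ _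
  -- the inclusion `U(Φ₂)_w ↪ M₂(ℂ)` is a closed embedding (compact support of restricted ambient test functions)
  have hce : ∀ w : {w : InfinitePlace L // IsComplex w}, IsClosedEmbedding (fun g : ↥(archLocal L 2 (Matrix.of fun i j : Fin 2 => if i.val + j.val + 1 = 2 then (1 : L) else 0) w) => ((g : GL (Fin 2) ℂ) : Matrix (Fin 2) (Fin 2) ℂ)) := fun w =>
    isClosedEmbedding_coe_unitaryGroupOfForm_of_eq_over (by rw [Literature.NumberTheory.Rogawski1990.antidiagOne_map, StdForm.over_antidiagonal_eq])
  /- 1 · CENTRES AND BOXES: the blocks of `cb`, the (N1″) radius `ε`, the blockwise balls `U w`. -/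
  obtain ⟨a₀, ha₀⟩ : ∃ a₀ : ∀ w : {w : InfinitePlace L // IsComplex w}, ↥(archLocal L 2 (Matrix.of fun i j : Fin 2 => if i.val + j.val + 1 = 2 then (1 : L) else 0) w), a₀ = fun w => endoBlockAt L S₀ w (cb w) := ⟨_, rfl⟩
  obtain ⟨b₀, hb₀⟩ : ∃ b₀ : ↥(arch (↥(maximalRealSubfield L)) L (IsCMField.complexConj L) 1 (Matrix.of fun i j : Fin 1 => if i.val + j.val + 1 = 1 then (1 : L) else 0)), b₀ = (endoTorus L S₀ cb).2 := ⟨_, rfl⟩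
  obtain ⟨ε, hε, hN1⟩ := exists_pos_archSmooth₂_of_blockSupport L a₀ b₀
  obtain ⟨A, hA⟩ : ∃ A : {w : InfinitePlace L // IsComplex w} → Matrix (Fin 2) (Fin 2) ℂ, A = fun w => ((a₀ w : GL (Fin 2) ℂ) : Matrix (Fin 2) (Fin 2) ℂ) := ⟨_, rfl⟩
  obtain ⟨U, hU⟩ : ∃ U : {w : InfinitePlace L // IsComplex w} → Set (Matrix (Fin 2) (Fin 2) ℂ), U = fun w =>
    {X | ‖X 0 0 - A w 0 0‖ ^ 2 + ‖X 0 1 - A w 0 1‖ ^ 2 + ‖X 1 0 - A w 1 0‖ ^ 2 + ‖X 1 1 - A w 1 1‖ ^ 2 < ε} := ⟨_, rfl⟩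
  have hUopen : ∀ w, IsOpen (U w) := fun w => by
    rw [hU]
    refine isOpen_lt ?_ continuous_const
    have hent : ∀ i j : Fin 2, Continuous fun X : Matrix (Fin 2) (Fin 2) ℂ => ‖X i j - A w i j‖ ^ 2 := fun i j =>
      ((continuous_id.matrix_elem i j).sub continuous_const).norm.pow 2
    exact (((hent 0 0).add (hent 0 1)).add (hent 1 0)).add (hent 1 1)
  have hAU : ∀ w, A w ∈ U w := fun w => by
    rw [hU]
    show ‖A w 0 0 - A w 0 0‖ ^ 2 + ‖A w 0 1 - A w 0 1‖ ^ 2 + ‖A w 1 0 - A w 1 0‖ ^ 2 + ‖A w 1 1 - A w 1 1‖ ^ 2 < ε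
    simpa using hε
  -- at a central place the block of `cb` IS `e^{iθ_w}·1`, `θ_w = cb w 0`
  have hAcen : ∀ w ∈ Z, A w = ((Circle.exp (cb w 0) : ℂ)) • (1 : Matrix (Fin 2) (Fin 2) ℂ) := fun w hw => by
    rw [hA, ha₀]; exact coe_endoBlockAt_of_not_mem_of_eq L S₀ w (hZ w hw) (hcen w hw)
  have hUnhds : ∀ w ∈ Z, U w ∈ 𝓝 ((((Circle.exp (cb w 0) : Circle) : ℂ)) • (1 : Matrix (Fin 2) (Fin 2) ℂ)) := fun w hw => by
    rw [← hAcen w hw]; exact (hUopen w).mem_nhds (hAU w)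
  /- 2 · THE LOCAL FACTORS: rank-one generators at the central places (split type on `T`, compact type on `Z ∖ T`), a positive bump elsewhere. -/
  have hsp' : ∀ w ∈ T, ∃ (f₀ : Matrix (Fin 2) (Fin 2) ℂ → ℂ) (G : ℝ × ℝ → ℂ), ContDiff ℝ ∞ f₀ ∧ HasCompactSupport f₀ ∧ tsupport f₀ ⊆ U w ∧
      (∀ X, 0 ≤ (f₀ X).re ∧ (f₀ X).im = 0) ∧ f₀ ((((Circle.exp (cb w 0) : Circle) : ℂ)) • 1) = 1 ∧ ContDiff ℝ ∞ G ∧ (∀ x θ, G (-x, θ) = G (x, θ)) ∧ G (0, cb w 0) ≠ 0 ∧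
      ∀ S : Finset {w : InfinitePlace L // IsComplex w}, w ∈ S → ∀ cw : Fin 3 → ℝ, cw 0 ≠ 0 →
        (((|Real.exp (cw 0) - Real.exp (-(cw 0))| : ℝ) : ℂ) * chartOrbHLoc L S w (νw w) (fun g => f₀ ((g : GL (Fin 2) ℂ) : Matrix (Fin 2) (Fin 2) ℂ)) cw) = G (cw 0, cw 2) :=
    fun w hw => hGsp w (νw w) (cb w 0) (U w) (hUnhds w (hT hw))
  have hcp' : ∀ w ∈ Z \ T, ∃ (f₀ : Matrix (Fin 2) (Fin 2) ℂ → ℂ) (δ : ℝ) (ℓ : ℂ), ContDiff ℝ ∞ f₀ ∧ HasCompactSupport f₀ ∧ tsupport f₀ ⊆ U w ∧ 0 < δ ∧ ℓ ≠ 0 ∧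
      (∀ S : Finset {w : InfinitePlace L // IsComplex w}, w ∈ S → ∀ cw : Fin 3 → ℝ, cw 0 ≠ 0 → |cw 0| < δ → dist (Circle.exp (cw 2)) (Circle.exp (cb w 0)) < δ →
        chartOrbHLoc L S w (νw w) (fun g => f₀ ((g : GL (Fin 2) ℂ) : Matrix (Fin 2) (Fin 2) ℂ)) cw = 0) ∧
      (∀ S : Finset {w : InfinitePlace L // IsComplex w}, w ∉ S → ∀ v₀ : Fin 3 → ℝ, Circle.exp (v₀ 0) = Circle.exp (cb w 0) → Circle.exp (v₀ 2) = Circle.exp (cb w 0) →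
        Tendsto (fun v : Fin 3 → ℝ => chartOrbHLoc L S w (νw w) (fun g => f₀ ((g : GL (Fin 2) ℂ) : Matrix (Fin 2) (Fin 2) ℂ)) v +
            chartOrbHLoc L S w (νw w) (fun g => f₀ ((g : GL (Fin 2) ℂ) : Matrix (Fin 2) (Fin 2) ℂ)) ![v 2, v 1, v 0])
          (𝓝[{v : Fin 3 → ℝ | Circle.exp (v 0) ≠ Circle.exp (v 2)}] v₀) (𝓝 ℓ)) :=
    fun w hw => hGcp w (νw w) (cb w 0) (U w) (hUnhds w (Finset.mem_sdiff.1 hw).1)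
  choose! fsp Gsp hfsp_smooth hfsp_cpt hfsp_supp hfsp_real hfsp_one hGsp_smooth hGsp_even hGsp_ne hfsp_read using hsp'
  choose! fcp δcp ℓcp hfcp_smooth hfcp_cpt hfcp_supp hδcp hℓcp hfcp_van hfcp_lim using hcp'
  -- the positive bump at the regular places: a `ContDiffBump` at the block `A w` supported inside the box `U w`; the model bump `βb` of the `U(Φ₁)`-factor
  have hrad : ∀ w, ∃ r : ℝ, 0 < r ∧ Metric.ball (A w) r ⊆ U w := fun w => Metric.isOpen_iff.1 (hUopen w) (A w) (hAU w)
  choose r hr hrU using hrad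
  let χ : ∀ w : {w : InfinitePlace L // IsComplex w}, ContDiffBump (A w) := fun w => ⟨r w / 2, r w, half_pos (hr w), half_lt_self (hr w)⟩
  obtain ⟨Fr, hFr⟩ : ∃ Fr : {w : InfinitePlace L // IsComplex w} → Matrix (Fin 2) (Fin 2) ℂ → ℝ, Fr = fun w X => χ w X := ⟨_, rfl⟩
  have hFr_smooth : ∀ w, ContDiff ℝ ∞ (Fr w) := fun w => by rw [hFr]; exact (χ w).contDiff
  have hFr_cpt : ∀ w, HasCompactSupport (Fr w) := fun w => by rw [hFr]; exact (χ w).hasCompactSupport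
  have hFr_nonneg : ∀ w X, 0 ≤ Fr w X := fun w X => by rw [hFr]; exact (χ w).nonneg
  have hFr_one : ∀ w, Fr w (A w) = 1 := fun w => by rw [hFr]; exact (χ w).one_of_mem_closedBall (Metric.mem_closedBall_self (χ w).rIn_pos.le)
  have hFr_supp : ∀ w X, Fr w X ≠ 0 → X ∈ U w := fun w X hX => by
    have hmem : X ∈ Function.support (χ w : Matrix (Fin 2) (Fin 2) ℂ → ℝ) := by rw [hFr] at hX; exact hX
    rw [(χ w).support_eq] at hmem
    exact hrU w hmem
  obtain ⟨βb, hβb⟩ : ∃ βb : ContDiffBump (0 : ℝ), βb.rOut = ε := ⟨⟨ε / 2, ε, half_pos hε, half_lt_self hε⟩, rfl⟩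
  have hβb_lt : ∀ x : ℝ, 0 ≤ x → βb x ≠ 0 → x < ε := fun x hx h => by
    by_contra hge
    exact h (βb.zero_of_le_dist (by rw [hβb, Real.dist_eq, sub_zero, abs_of_nonneg hx]; exact not_lt.1 hge))
  -- the ambient local factor at every place
  obtain ⟨F, hF⟩ : ∃ F : {w : InfinitePlace L // IsComplex w} → Matrix (Fin 2) (Fin 2) ℂ → ℂ, F = fun w X =>
    if w ∈ T then fsp w X else if w ∈ Z then fcp w X else ((Fr w X : ℝ) : ℂ) := ⟨_, rfl⟩
  have hF_T : ∀ w ∈ T, F w = fsp w := fun w hw => by funext X; simp only [hF, if_pos hw]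
  have hF_ZT : ∀ w ∈ Z \ T, F w = fcp w := fun w hw => by
    funext X; simp only [hF, if_neg (Finset.mem_sdiff.1 hw).2, if_pos (Finset.mem_sdiff.1 hw).1]
  have hF_reg : ∀ w, w ∉ Z → F w = fun X => ((Fr w X : ℝ) : ℂ) := fun w hw => by
    funext X; simp only [hF, if_neg (fun h => hw (hT h)), if_neg hw]
  have hF_smooth : ∀ w, ContDiff ℝ ∞ (F w) := fun w => by
    by_cases hwT : w ∈ T
    · rw [hF_T w hwT]; exact hfsp_smooth w hwT
    · by_cases hwZ : w ∈ Z
      · rw [hF_ZT w (Finset.mem_sdiff.2 ⟨hwZ, hwT⟩)]; exact hfcp_smooth w (Finset.mem_sdiff.2 ⟨hwZ, hwT⟩)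
      · rw [hF_reg w hwZ]
        have h := (Complex.ofRealCLM.contDiff (n := ∞)).comp (hFr_smooth w)
        simpa only [Function.comp_def, Complex.ofRealCLM_apply] using h
  have hF_cpt : ∀ w, HasCompactSupport (F w) := fun w => by
    by_cases hwT : w ∈ T
    · rw [hF_T w hwT]; exact hfsp_cpt w hwT
    · by_cases hwZ : w ∈ Z
      · rw [hF_ZT w (Finset.mem_sdiff.2 ⟨hwZ, hwT⟩)]; exact hfcp_cpt w (Finset.mem_sdiff.2 ⟨hwZ, hwT⟩)
      · rw [hF_reg w hwZ]; exact (hFr_cpt w).comp_left Complex.ofReal_zero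
  have hF_supp : ∀ w X, F w X ≠ 0 → X ∈ U w := fun w X hX => by
    by_cases hwT : w ∈ T
    · rw [hF_T w hwT] at hX; exact hfsp_supp w hwT (subset_tsupport _ hX)
    · by_cases hwZ : w ∈ Z
      · rw [hF_ZT w (Finset.mem_sdiff.2 ⟨hwZ, hwT⟩)] at hX; exact hfcp_supp w (Finset.mem_sdiff.2 ⟨hwZ, hwT⟩) (subset_tsupport _ hX)
      · rw [hF_reg w hwZ] at hX
        exact hFr_supp w X (fun h => hX (by simp only [h, Complex.ofReal_zero]))
  -- the local factors on the groups and the `U(Φ₁)`-factor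
  obtain ⟨f, hf⟩ : ∃ f : ∀ w : {w : InfinitePlace L // IsComplex w}, ↥(archLocal L 2 (Matrix.of fun i j : Fin 2 => if i.val + j.val + 1 = 2 then (1 : L) else 0) w) → ℂ, f = fun w (x : ↥(archLocal L 2 (Matrix.of fun i j : Fin 2 => if i.val + j.val + 1 = 2 then (1 : L) else 0) w)) => F w ((x : GL (Fin 2) ℂ) : Matrix (Fin 2) (Fin 2) ℂ) := ⟨_, rfl⟩
  have hf_cont : ∀ w, Continuous (f w) := fun w => by rw [hf]; exact (hF_smooth w).continuous.comp (hce w).continuous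
  have hf_cpt : ∀ w, HasCompactSupport (f w) := fun w => by rw [hf]; exact (hF_cpt w).comp_isClosedEmbedding (hce w)
  obtain ⟨u₀, hu₀⟩ : ∃ u₀ : {w : InfinitePlace L // IsComplex w} → ℂ, u₀ = fun w => (((archPiEquivCM 1 L (Matrix.of fun i j : Fin 1 => if i.val + j.val + 1 = 1 then (1 : L) else 0)) b₀ w : GL (Fin 1) ℂ) : Matrix (Fin 1) (Fin 1) ℂ) 0 0 := ⟨_, rfl⟩
  obtain ⟨gB, hgB⟩ : ∃ gB : ↥(arch (↥(maximalRealSubfield L)) L (IsCMField.complexConj L) 1 (Matrix.of fun i j : Fin 1 => if i.val + j.val + 1 = 1 then (1 : L) else 0)) → ℂ, gB = fun b => (((∏ w : {w : InfinitePlace L // IsComplex w}, βb (‖(((archPiEquivCM 1 L (Matrix.of fun i j : Fin 1 => if i.val + j.val + 1 = 1 then (1 : L) else 0)) b w : GL (Fin 1) ℂ) : Matrix (Fin 1) (Fin 1) ℂ) 0 0 - u₀ w‖ ^ 2)) : ℝ) : ℂ) := ⟨_, rfl⟩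
  have hu_cont : ∀ w : {w : InfinitePlace L // IsComplex w}, Continuous fun b : ↥(arch (↥(maximalRealSubfield L)) L (IsCMField.complexConj L) 1 (Matrix.of fun i j : Fin 1 => if i.val + j.val + 1 = 1 then (1 : L) else 0)) => (((archPiEquivCM 1 L (Matrix.of fun i j : Fin 1 => if i.val + j.val + 1 = 1 then (1 : L) else 0)) b w : GL (Fin 1) ℂ) : Matrix (Fin 1) (Fin 1) ℂ) 0 0 := fun w =>
    ((Units.continuous_val.comp (continuous_subtype_val.comp ((continuous_apply w).comp (archPiEquivCM 1 L (Matrix.of fun i j : Fin 1 => if i.val + j.val + 1 = 1 then (1 : L) else 0)).continuous))).matrix_elem 0 0)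
  have hgB_cont : Continuous gB := by
    rw [hgB]
    exact Complex.continuous_ofReal.comp (continuous_finsetProd _ fun w _ => βb.continuous.comp (((hu_cont w).sub continuous_const).norm.pow 2))
  /- 3 · THE TENSOR TEST FUNCTION `g_T` and its `ArchSmooth₂` certificate ((N1″)). -/
  obtain ⟨N, hN⟩ : ∃ N : ({w : InfinitePlace L // IsComplex w} → Matrix (Fin 2) (Fin 2) ℂ) × ({w : InfinitePlace L // IsComplex w} → ℂ) → ℂ, N = fun p => (∏ w, F w (p.1 w)) * (((∏ w : {w : InfinitePlace L // IsComplex w}, βb (‖p.2 w - u₀ w‖ ^ 2)) : ℝ) : ℂ) :=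
    ⟨_, rfl⟩
  have hNsmooth : ContDiff ℝ ∞ N := by
    rw [hN]
    refine ContDiff.mul (contDiff_prod fun w _ => (hF_smooth w).comp (contDiff_pi.1 contDiff_fst w)) ?_
    have hR : ContDiff ℝ ∞ fun p : ({w : InfinitePlace L // IsComplex w} → Matrix (Fin 2) (Fin 2) ℂ) × ({w : InfinitePlace L // IsComplex w} → ℂ) => ∏ w : {w : InfinitePlace L // IsComplex w}, βb (‖p.2 w - u₀ w‖ ^ 2) :=
      contDiff_prod fun w _ => βb.contDiff.comp ((contDiff_norm_sq ℝ).comp ((contDiff_pi.1 contDiff_snd w).sub contDiff_const))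
    have h := (Complex.ofRealCLM.contDiff (n := ∞)).comp hR
    simpa only [Function.comp_def, Complex.ofRealCLM_apply] using h
  have hNsupp : ∀ p, N p ≠ 0 →
      (∀ w, ‖p.1 w 0 0 - ((a₀ w : GL (Fin 2) ℂ) : Matrix (Fin 2) (Fin 2) ℂ) 0 0‖ ^ 2 + ‖p.1 w 0 1 - ((a₀ w : GL (Fin 2) ℂ) : Matrix (Fin 2) (Fin 2) ℂ) 0 1‖ ^ 2 +
            ‖p.1 w 1 0 - ((a₀ w : GL (Fin 2) ℂ) : Matrix (Fin 2) (Fin 2) ℂ) 1 0‖ ^ 2 + ‖p.1 w 1 1 - ((a₀ w : GL (Fin 2) ℂ) : Matrix (Fin 2) (Fin 2) ℂ) 1 1‖ ^ 2 ≤ ε) ∧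
      (∀ w, ‖p.2 w - (((archPiEquivCM 1 L (Matrix.of fun i j : Fin 1 => if i.val + j.val + 1 = 1 then (1 : L) else 0)) b₀ w : GL (Fin 1) ℂ) : Matrix (Fin 1) (Fin 1) ℂ) 0 0‖ ^ 2 ≤ ε) := by
    intro p hp
    rw [hN] at hp
    have h1 : ∀ w, F w (p.1 w) ≠ 0 := fun w => Finset.prod_ne_zero_iff.1 (left_ne_zero_of_mul hp) w (Finset.mem_univ w)
    have h2 : ∀ w, βb (‖p.2 w - u₀ w‖ ^ 2) ≠ 0 := fun w =>
      Finset.prod_ne_zero_iff.1 (Complex.ofReal_ne_zero.1 (right_ne_zero_of_mul hp)) w (Finset.mem_univ w)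
    refine ⟨fun w => ?_, fun w => ?_⟩
    · have hX := hF_supp w _ (h1 w)
      rw [hU] at hX
      have hX' : ‖p.1 w 0 0 - A w 0 0‖ ^ 2 + ‖p.1 w 0 1 - A w 0 1‖ ^ 2 + ‖p.1 w 1 0 - A w 1 0‖ ^ 2 + ‖p.1 w 1 1 - A w 1 1‖ ^ 2 < ε := hX
      rw [hA] at hX'
      exact hX'.le
    · have hlt := hβb_lt _ (by positivity) (h2 w)
      rw [hu₀] at hlt
      exact hlt.le
  obtain ⟨gT, hgT⟩ : ∃ gT : (↥(arch (↥(maximalRealSubfield L)) L (IsCMField.complexConj L) 2 (Matrix.of fun i j : Fin 2 => if i.val + j.val + 1 = 2 then (1 : L) else 0)) × ↥(arch (↥(maximalRealSubfield L)) L (IsCMField.complexConj L) 1 (Matrix.of fun i j : Fin 1 => if i.val + j.val + 1 = 1 then (1 : L) else 0))) → ℂ, gT = fun k => N ((fun w => (((archPiEquivCM 2 L (Matrix.of fun i j : Fin 2 => if i.val + j.val + 1 = 2 then (1 : L) else 0)) k.1 w : GL (Fin 2) ℂ) : Matrix (Fin 2) (Fin 2) ℂ)),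
    (fun w => (((archPiEquivCM 1 L (Matrix.of fun i j : Fin 1 => if i.val + j.val + 1 = 1 then (1 : L) else 0)) k.2 w : GL (Fin 1) ℂ) : Matrix (Fin 1) (Fin 1) ℂ) 0 0)) := ⟨_, rfl⟩
  have hgT_smooth : ArchSmooth₂ L gT := by rw [hgT]; exact hN1 N hNsmooth hNsupp
  have hfH : ∀ a b, gT (a, b) = (∏ w, f w ((archPiEquivCM 2 L (Matrix.of fun i j : Fin 2 => if i.val + j.val + 1 = 2 then (1 : L) else 0)) a w)) * gB b := fun a b => by simp only [hgT, hN, hf, hgB]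
  refine ⟨gT, hgT_smooth, ?_, ?_⟩
  · /- 4 · (G1): on a chart `S₀ ∪ T′`, `T′ ⊄ T`, a place `w ∈ T′ ∖ T` is SPLIT and carries the compact-type generator, whose split reading vanishes near the central class. -/
    obtain ⟨δ, hδ, hδle⟩ := exists_pos_le_forall_mem_finset (Z \ T) (fun w hw => hδcp w hw)
    obtain ⟨ε₁, hε₁, hnear⟩ := exists_forall_abs_lt_and_dist_circleExp_lt_of_dist_bzClassMap_lt (W := {w : InfinitePlace L // IsComplex w}) hδ
    refine ⟨ε₁, hε₁, fun T' hT'Z hT'T c hc hd => ?_⟩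
    obtain ⟨w, hwT', hwT⟩ := Finset.not_subset.1 hT'T
    have hwZT : w ∈ Z \ T := Finset.mem_sdiff.2 ⟨hT'Z hwT', hwT⟩
    have hwS : w ∈ S₀ ∪ T' := Finset.mem_union_right S₀ hwT'
    obtain ⟨hx, hθ⟩ := hnear (S₀ ∪ T') S₀ c cb w hwS (hZ w (hT'Z hwT')) (hcen w (hT'Z hwT')) hd
    have h0 : chartOrbHLoc L (S₀ ∪ T') w (νw w) (f w) (c w) = 0 := by
      have hfw : f w = fun x : ↥(archLocal L 2 (Matrix.of fun i j : Fin 2 => if i.val + j.val + 1 = 2 then (1 : L) else 0) w) => fcp w ((x : GL (Fin 2) ℂ) : Matrix (Fin 2) (Fin 2) ℂ) := by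
        funext x; simp only [hf, hF_ZT w hwZT]
      rw [hfw]
      exact hfcp_van w hwZT (S₀ ∪ T') hwS (c w) (hc.2 w hwS) (hx.trans_le (hδle w hwZT)) (hθ.trans_le (hδle w hwZT))
    exact stOrbFamH_eq_zero_of_chartOrbHLoc_eq_zero L νw νH gT f gB hfH (S₀ ∪ T') hc hwS h0
  · /- 5 · (G3): at the fibre point of `S₀ ∪ T` the quotient by the compact part tends to the product of the per-place limits, all non-zero. -/
    obtain ⟨c₀, hc₀⟩ : ∃ c₀ : {w : InfinitePlace L // IsComplex w} → Fin 3 → ℝ, c₀ = fun w => if w ∈ T then ![0, cb w 1, cb w 0] else cb w := ⟨_, rfl⟩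
    have hc₀T : ∀ w ∈ T, c₀ w = ![0, cb w 1, cb w 0] := fun w hw => by rw [hc₀]; exact if_pos hw
    have hc₀nT : ∀ w, w ∉ T → c₀ w = cb w := fun w hw => by rw [hc₀]; exact if_neg hw
    -- the per-place limits
    obtain ⟨ℓ, hℓ⟩ : ∃ ℓ : {w : InfinitePlace L // IsComplex w} → ℂ, ℓ = fun w =>
        if w ∈ T then Gsp w (0, cb w 0)
        else if w ∈ Z then ℓcp w
        else if w ∈ S₀ then (((|Real.exp (cb w 0) - Real.exp (-cb w 0)| : ℝ) : ℂ) * chartOrbHLoc L (S₀ ∪ T) w (νw w) (f w) (cb w))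
        else (chartOrbHLoc L (S₀ ∪ T) w (νw w) (f w) (cb w) + chartOrbHLoc L (S₀ ∪ T) w (νw w) (f w) ![cb w 2, cb w 1, cb w 0]) := ⟨_, rfl⟩
    have hℓT : ∀ w ∈ T, ℓ w = Gsp w (0, cb w 0) := fun w hw => by rw [hℓ]; exact if_pos hw
    have hℓZT : ∀ w ∈ Z \ T, ℓ w = ℓcp w := fun w hw => by
      rw [hℓ]; simp only [if_neg (Finset.mem_sdiff.1 hw).2, if_pos (Finset.mem_sdiff.1 hw).1]
    have hℓS₀ : ∀ w ∈ S₀, ℓ w = (((|Real.exp (cb w 0) - Real.exp (-cb w 0)| : ℝ) : ℂ) * chartOrbHLoc L (S₀ ∪ T) w (νw w) (f w) (cb w)) := fun w hw => by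
      have hwZ : w ∉ Z := fun h => hZ w h hw
      rw [hℓ]; simp only [if_neg (fun h => hwZ (hT h)), if_neg hwZ, if_pos hw]
    have hℓC : ∀ w, w ∉ S₀ → w ∉ Z →
        ℓ w = chartOrbHLoc L (S₀ ∪ T) w (νw w) (f w) (cb w) + chartOrbHLoc L (S₀ ∪ T) w (νw w) (f w) ![cb w 2, cb w 1, cb w 0] := fun w hw₀ hwZ => by
      rw [hℓ]; simp only [if_neg (fun h => hwZ (hT h)), if_neg hwZ, if_neg hw₀]
    -- membership bookkeeping on the level chart
    have hmemS : ∀ w, w ∈ S₀ ∪ T ↔ w ∈ S₀ ∨ w ∈ T := fun w => Finset.mem_union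
    -- the `U(Φ₁)`-factor at the fibre point: all bumps at their centres
    have hsnd : (endoTorus L (S₀ ∪ T) c₀).2 = b₀ := by
      rw [hb₀]
      exact endoTorus_snd_eq_of_forall_apply_one L (S₀ ∪ T) S₀ fun w => by
        by_cases hw : w ∈ T
        · rw [hc₀T w hw]; rfl
        · rw [hc₀nT w hw]
    have hgB₀ : gB (endoTorus L (S₀ ∪ T) c₀).2 = 1 := by
      rw [hsnd, hgB]
      have h1 : ∀ w : {w : InfinitePlace L // IsComplex w}, βb (‖(((archPiEquivCM 1 L (Matrix.of fun i j : Fin 1 => if i.val + j.val + 1 = 1 then (1 : L) else 0)) b₀ w : GL (Fin 1) ℂ) : Matrix (Fin 1) (Fin 1) ℂ) 0 0 - u₀ w‖ ^ 2) = 1 := fun w => by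
        rw [hu₀]
        simp only [sub_self, norm_zero, ne_eq, OfNat.ofNat_ne_zero, not_false_eq_true, zero_pow]
        exact βb.one_of_mem_closedBall (Metric.mem_closedBall_self βb.rIn_pos.le)
      simp only [h1, Finset.prod_const_one, Complex.ofReal_one]
    refine ⟨c₀, ((haarScalarFactor νH (((Measure.pi νw).map (archPiEquivCM 2 L (Matrix.of fun i j : Fin 2 => if i.val + j.val + 1 = 2 then (1 : L) else 0)).symm).prod νB) : ℝ) : ℂ) *
        ((νB.real Set.univ : ℂ) * gB (endoTorus L (S₀ ∪ T) c₀).2) * ∏ w, ℓ w, ?_, ?_, ?_, ?_⟩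
    · -- the class of the fibre point
      rw [hc₀]; exact bzClassMap_union_levelPt S₀ T (fun w hw => hZ w (hT hw)) cb (fun w hw => hcen w (hT hw))
    · -- in the closure of the regular set
      rw [hc₀]; exact levelPt_mem_closure_regS S₀ Z T hZ hT cb hsp hcp (fun w hw => by rw [hcen w hw])
    · -- the limit is non-zero
      refine mul_ne_zero (mul_ne_zero ?_ (mul_ne_zero ?_ ?_)) (Finset.prod_ne_zero_iff.2 fun w _ => ?_)
      · exact Complex.ofReal_ne_zero.2 (NNReal.coe_ne_zero.2 hΛ.ne')
      · exact Complex.ofReal_ne_zero.2 hB.ne'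
      · rw [hgB₀]; exact one_ne_zero
      · by_cases hwT : w ∈ T
        · rw [hℓT w hwT]; exact hGsp_ne w hwT
        · by_cases hwZ : w ∈ Z
          · rw [hℓZT w (Finset.mem_sdiff.2 ⟨hwZ, hwT⟩)]; exact hℓcp w (Finset.mem_sdiff.2 ⟨hwZ, hwT⟩)
          · -- regular places: the positive bump at the block of `cb`
            have hfw : f w = fun x : ↥(archLocal L 2 (Matrix.of fun i j : Fin 2 => if i.val + j.val + 1 = 2 then (1 : L) else 0) w) => ((Fr w ((x : GL (Fin 2) ℂ) : Matrix (Fin 2) (Fin 2) ℂ) : ℝ) : ℂ) := by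
              rw [hf]; funext x; simp only [hF_reg w hwZ]
            have hFrc : Continuous fun x : ↥(archLocal L 2 (Matrix.of fun i j : Fin 2 => if i.val + j.val + 1 = 2 then (1 : L) else 0) w) => Fr w ((x : GL (Fin 2) ℂ) : Matrix (Fin 2) (Fin 2) ℂ) :=
              (hFr_smooth w).continuous.comp (hce w).continuous
            have hFrk : HasCompactSupport fun x : ↥(archLocal L 2 (Matrix.of fun i j : Fin 2 => if i.val + j.val + 1 = 2 then (1 : L) else 0) w) => Fr w ((x : GL (Fin 2) ℂ) : Matrix (Fin 2) (Fin 2) ℂ) :=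
              (hFr_cpt w).comp_isClosedEmbedding (hce w)
            have hblk : endoBlockAt L (S₀ ∪ T) w (cb w) = a₀ w := by
              rw [ha₀]; exact endoBlockAt_eq_of_mem_iff L (by rw [hmemS]; simp [hwT]) (cb w)
            have hpos : Fr w ((((1 : ↥(archLocal L 2 (Matrix.of fun i j : Fin 2 => if i.val + j.val + 1 = 2 then (1 : L) else 0) w)) * endoBlockAt L (S₀ ∪ T) w (cb w) * 1⁻¹ : ↥(archLocal L 2 (Matrix.of fun i j : Fin 2 => if i.val + j.val + 1 = 2 then (1 : L) else 0) w)) : GL (Fin 2) ℂ) : Matrix (Fin 2) (Fin 2) ℂ) ≠ 0 := by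
              rw [one_mul, inv_one, mul_one, hblk]
              have : Fr w (A w) ≠ 0 := by rw [hFr_one w]; exact one_ne_zero
              rw [hA] at this; exact this
            by_cases hw₀ : w ∈ S₀
            · have hwS : w ∈ S₀ ∪ T := Finset.mem_union_left T hw₀
              rw [hℓS₀ w hw₀, hfw]
              exact absExpSub_mul_chartOrbHLoc_ofReal_ne_zero_of_nonneg L (S₀ ∪ T) w (νw w) (cb w) (hsp w hw₀) hFrc (fun x => hFr_nonneg w _)
                (hasCompactSupport_descConj_endoBlockAt_of_mem L (S₀ ∪ T) w hwS (hsp w hw₀) _ hFrk) (x₀ := 1) hpos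
            · have hwS : w ∉ S₀ ∪ T := by rw [hmemS]; push Not; exact ⟨hw₀, hwT⟩
              rw [hℓC w hw₀ hwZ, hfw]
              obtain ⟨r₁, hr₁, h₁⟩ := chartOrbHLoc_ofReal_eq_ofReal_pos_of_nonneg L (S₀ ∪ T) w (νw w) (cb w) hFrc (fun x => hFr_nonneg w _)
                (hasCompactSupport_descConj_endoBlockAt_of_not_mem L (S₀ ∪ T) w hwS (hcp w hw₀ hwZ) _ hFrk) (x₀ := 1) hpos
              obtain ⟨r₂, hr₂, h₂⟩ := chartOrbHLoc_ofReal_eq_ofReal_nonneg L (S₀ ∪ T) w (νw w) ![cb w 2, cb w 1, cb w 0] (f := fun x => Fr w ((x : GL (Fin 2) ℂ) : Matrix (Fin 2) (Fin 2) ℂ))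
                (fun x => hFr_nonneg w _)
              rw [h₁, h₂, ← Complex.ofReal_add, Complex.ofReal_ne_zero]
              exact (add_pos_of_pos_of_nonneg hr₁ hr₂).ne'
    · -- the limit itself: ★ (P1) product reading, §1 quotient calculus, per-place limits
      refine tendsto_stOrbFamH_div_compactPart_of_prod L νw νB νH gT f gB hfH hgB_cont (S₀ ∪ T) c₀ (ℓ := ℓ) (fun w hwS => ?_) (fun w hwS => ?_)
      · -- split places of the level chart: `T` (split central) and `S₀` (split regular)
        by_cases hwT : w ∈ T
        · have hfw : f w = fun x : ↥(archLocal L 2 (Matrix.of fun i j : Fin 2 => if i.val + j.val + 1 = 2 then (1 : L) else 0) w) => fsp w ((x : GL (Fin 2) ℂ) : Matrix (Fin 2) (Fin 2) ℂ) := by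
            rw [hf]; funext x; simp only [hF_T w hwT]
          rw [hℓT w hwT, hfw, hc₀T w hwT]
          have hR : ContinuousAt (fun v : Fin 3 → ℝ => Gsp w (v 0, v 2)) ![0, cb w 1, cb w 0] :=
            ((hGsp_smooth w hwT).continuous.comp ((continuous_apply 0).prodMk (continuous_apply 2))).continuousAt
          have h := tendsto_absExpSub_mul_of_eqOn_of_continuousAt (fun v hv => hfsp_read w hwT (S₀ ∪ T) hwS v hv) hR
          simpa only [Matrix.cons_val_zero, Matrix.cons_val_two, Matrix.tail_cons, Matrix.head_cons] using h
        · have hw₀ : w ∈ S₀ := ((hmemS w).1 hwS).resolve_right hwT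
          rw [hℓS₀ w hw₀, hc₀nT w hwT]
          have hca : ContinuousAt (chartOrbHLoc L (S₀ ∪ T) w (νw w) (f w)) (cb w) :=
            continuousAt_chartOrbHLoc_of_mem L (S₀ ∪ T) w (νw w) hwS (hsp w hw₀) (f w) (hf_cont w) (hf_cpt w)
          have habs : Continuous fun v : Fin 3 → ℝ => (((|Real.exp (v 0) - Real.exp (-v 0)| : ℝ) : ℂ)) :=
            Complex.continuous_ofReal.comp (((Real.continuous_exp.comp (continuous_apply 0)).sub
              (Real.continuous_exp.comp (continuous_apply 0).neg)).abs)
          exact (habs.continuousAt.mul hca).tendsto.mono_left nhdsWithin_le_nhds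
      · -- compact places of the level chart: `Z ∖ T` (compact central) and the compact regular places
        have hwT : w ∉ T := fun h => hwS (Finset.mem_union_right S₀ h)
        have hw₀ : w ∉ S₀ := fun h => hwS (Finset.mem_union_left T h)
        by_cases hwZ : w ∈ Z
        · have hwZT : w ∈ Z \ T := Finset.mem_sdiff.2 ⟨hwZ, hwT⟩
          have hfw : f w = fun x : ↥(archLocal L 2 (Matrix.of fun i j : Fin 2 => if i.val + j.val + 1 = 2 then (1 : L) else 0) w) => fcp w ((x : GL (Fin 2) ℂ) : Matrix (Fin 2) (Fin 2) ℂ) := by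
            rw [hf]; funext x; simp only [hF_ZT w hwZT]
          rw [hℓZT w hwZT, hfw, hc₀nT w hwT]
          exact hfcp_lim w hwZT (S₀ ∪ T) hwS (cb w) rfl (by rw [hcen w hwZ])
        · rw [hℓC w hw₀ hwZ, hc₀nT w hwT]
          have hreg : Circle.exp (cb w 0) ≠ Circle.exp (cb w 2) := hcp w hw₀ hwZ
          have h1 : ContinuousAt (chartOrbHLoc L (S₀ ∪ T) w (νw w) (f w)) (cb w) :=
            continuousAt_chartOrbHLoc_of_not_mem L (S₀ ∪ T) w (νw w) hwS hreg (f w) (hf_cont w) (hf_cpt w)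
          have h2 : ContinuousAt (chartOrbHLoc L (S₀ ∪ T) w (νw w) (f w)) ![cb w 2, cb w 1, cb w 0] :=
            continuousAt_chartOrbHLoc_flip_of_not_mem L (S₀ ∪ T) w (νw w) hwS hreg (f w) (hf_cont w) (hf_cpt w)
          have hflip : Continuous fun v : Fin 3 → ℝ => (![v 2, v 1, v 0] : Fin 3 → ℝ) :=
            continuous_pi fun i => by fin_cases i <;> simp <;> exact continuous_apply _
          have h2' : ContinuousAt (fun v : Fin 3 → ℝ => chartOrbHLoc L (S₀ ∪ T) w (νw w) (f w) ![v 2, v 1, v 0]) (cb w) :=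
            ContinuousAt.comp (g := chartOrbHLoc L (S₀ ∪ T) w (νw w) (f w)) h2 hflip.continuousAt
          exact (h1.add h2').tendsto.mono_left nhdsWithin_le_nhds


/-- **(W3-asm) IN THE BRICKS CURRENCY** — the `hGen` hypothesis of ★ `bzLocalSurjWall_of_bricks` (p851580) TOKEN FOR TOKEN (any chart point `c_b` of any chart `S_b` with class
`b`; `Z(b)` the inline central predicate, `S₀(b) = S_b.filter (¬ central)`): the reference chart point of the most compact chart is (F2) at `T = ∅` (★ `exists_fibrePoint_wall_bricks`,
LH1-p03 (g7)), then `wallGenerators_of_parts`.  INPUTS BY STATEMENT: the (W3-G) generators `hGsp`, `hGcp`. [cite: Bouaziz1994IntegralesOrbitales, §4 pp. 585–586; §5.1 p. 588]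
[cite: Shelstad1979, §4 Thm. 4.7 p. 31] -/
theorem wallGenerators_bricks_of_parts
    [iH : MeasurableSpace (↥(arch (↥(maximalRealSubfield L)) L (IsCMField.complexConj L) 2 (Matrix.of fun i j : Fin 2 => if i.val + j.val + 1 = 2 then (1 : L) else 0)) × ↥(arch (↥(maximalRealSubfield L)) L (IsCMField.complexConj L) 1 (Matrix.of fun i j : Fin 1 => if i.val + j.val + 1 = 1 then (1 : L) else 0)))] [iHB : BorelSpace (↥(arch (↥(maximalRealSubfield L)) L (IsCMField.complexConj L) 2 (Matrix.of fun i j : Fin 2 => if i.val + j.val + 1 = 2 then (1 : L) else 0)) × ↥(arch (↥(maximalRealSubfield L)) L (IsCMField.complexConj L) 1 (Matrix.of fun i j : Fin 1 => if i.val + j.val + 1 = 1 then (1 : L) else 0)))] (νH : Measure (↥(arch (↥(maximalRealSubfield L)) L (IsCMField.complexConj L) 2 (Matrix.of fun i j : Fin 2 => if i.val + j.val + 1 = 2 then (1 : L) else 0)) × ↥(arch (↥(maximalRealSubfield L)) L (IsCMField.complexConj L) 1 (Matrix.of fun i j : Fin 1 => if i.val + j.val + 1 = 1 then (1 : L) else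 0)))) [νH.IsHaarMeasure] [νH.IsMulRightInvariant]
    (hGsp : ∀ (w : {w : InfinitePlace L // IsComplex w}) [MeasurableSpace ↥(archLocal L 2 (Matrix.of fun i j : Fin 2 => if i.val + j.val + 1 = 2 then (1 : L) else 0) w)] [BorelSpace ↥(archLocal L 2 (Matrix.of fun i j : Fin 2 => if i.val + j.val + 1 = 2 then (1 : L) else 0) w)] (νw : Measure ↥(archLocal L 2 (Matrix.of fun i j : Fin 2 => if i.val + j.val + 1 = 2 then (1 : L) else 0) w)) [νw.IsHaarMeasure] [νw.IsMulRightInvariant]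
      (θ₀ : ℝ) (U : Set (Matrix (Fin 2) (Fin 2) ℂ)), U ∈ 𝓝 ((((Circle.exp θ₀ : Circle) : ℂ)) • (1 : Matrix (Fin 2) (Fin 2) ℂ)) →
      ∃ (f₀ : Matrix (Fin 2) (Fin 2) ℂ → ℂ) (G : ℝ × ℝ → ℂ), ContDiff ℝ ∞ f₀ ∧ HasCompactSupport f₀ ∧ tsupport f₀ ⊆ U ∧ (∀ X, 0 ≤ (f₀ X).re ∧ (f₀ X).im = 0) ∧
        f₀ ((((Circle.exp θ₀ : Circle) : ℂ)) • 1) = 1 ∧ ContDiff ℝ ∞ G ∧ (∀ x θ, G (-x, θ) = G (x, θ)) ∧ G (0, θ₀) ≠ 0 ∧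
        ∀ S : Finset {w : InfinitePlace L // IsComplex w}, w ∈ S → ∀ cw : Fin 3 → ℝ, cw 0 ≠ 0 →
          (((|Real.exp (cw 0) - Real.exp (-(cw 0))| : ℝ) : ℂ) * chartOrbHLoc L S w νw (fun g => f₀ ((g : GL (Fin 2) ℂ) : Matrix (Fin 2) (Fin 2) ℂ)) cw) = G (cw 0, cw 2))
    (hGcp : ∀ (w : {w : InfinitePlace L // IsComplex w}) [MeasurableSpace ↥(archLocal L 2 (Matrix.of fun i j : Fin 2 => if i.val + j.val + 1 = 2 then (1 : L) else 0) w)] [BorelSpace ↥(archLocal L 2 (Matrix.of fun i j : Fin 2 => if i.val + j.val + 1 = 2 then (1 : L) else 0) w)] (νw : Measure ↥(archLocal L 2 (Matrix.of fun i j : Fin 2 => if i.val + j.val + 1 = 2 then (1 : L) else 0) w)) [νw.IsHaarMeasure] [νw.IsMulRightInvariant]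
      (θ₀ : ℝ) (U : Set (Matrix (Fin 2) (Fin 2) ℂ)), U ∈ 𝓝 ((((Circle.exp θ₀ : Circle) : ℂ)) • (1 : Matrix (Fin 2) (Fin 2) ℂ)) →
      ∃ (f₀ : Matrix (Fin 2) (Fin 2) ℂ → ℂ) (δ : ℝ) (ℓ : ℂ), ContDiff ℝ ∞ f₀ ∧ HasCompactSupport f₀ ∧ tsupport f₀ ⊆ U ∧ 0 < δ ∧ ℓ ≠ 0 ∧
        (∀ S : Finset {w : InfinitePlace L // IsComplex w}, w ∈ S → ∀ cw : Fin 3 → ℝ, cw 0 ≠ 0 → |cw 0| < δ → dist (Circle.exp (cw 2)) (Circle.exp θ₀) < δ →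
          chartOrbHLoc L S w νw (fun g => f₀ ((g : GL (Fin 2) ℂ) : Matrix (Fin 2) (Fin 2) ℂ)) cw = 0) ∧
        (∀ S : Finset {w : InfinitePlace L // IsComplex w}, w ∉ S → ∀ v₀ : Fin 3 → ℝ, Circle.exp (v₀ 0) = Circle.exp θ₀ → Circle.exp (v₀ 2) = Circle.exp θ₀ →
          Tendsto (fun v : Fin 3 → ℝ => chartOrbHLoc L S w νw (fun g => f₀ ((g : GL (Fin 2) ℂ) : Matrix (Fin 2) (Fin 2) ℂ)) v +
              chartOrbHLoc L S w νw (fun g => f₀ ((g : GL (Fin 2) ℂ) : Matrix (Fin 2) (Fin 2) ℂ)) ![v 2, v 1, v 0])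
            (𝓝[{v : Fin 3 → ℝ | Circle.exp (v 0) ≠ Circle.exp (v 2)}] v₀) (𝓝 ℓ))) :
    ∀ (b : {w : InfinitePlace L // IsComplex w} → ℂ × ℂ × ℂ) (S_b : Finset {w : InfinitePlace L // IsComplex w}) (c_b : {w : InfinitePlace L // IsComplex w} → Fin 3 → ℝ),
      bzClassMap S_b c_b = b → ∀ T, T ⊆ Finset.univ.filter (fun w => (b w).1 ^ 2 = 4 * (b w).2.1) →
      ∃ g : ↥(arch (↥(maximalRealSubfield L)) L (IsCMField.complexConj L) 2 (Matrix.of fun i j : Fin 2 => if i.val + j.val + 1 = 2 then (1 : L) else 0)) ×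
        ↥(arch (↥(maximalRealSubfield L)) L (IsCMField.complexConj L) 1 (Matrix.of fun i j : Fin 1 => if i.val + j.val + 1 = 1 then (1 : L) else 0)) → ℂ,
        ArchSmooth₂ L g ∧
        (∃ ε : ℝ, 0 < ε ∧ ∀ T', T' ⊆ Finset.univ.filter (fun w => (b w).1 ^ 2 = 4 * (b w).2.1) → ¬ T' ⊆ T →
          ∀ c, c ∈ RegS (S_b.filter (fun w => (b w).1 ^ 2 ≠ 4 * (b w).2.1) ∪ T') →
            dist (bzClassMap (S_b.filter (fun w => (b w).1 ^ 2 ≠ 4 * (b w).2.1) ∪ T') c) b < ε →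
            stOrbFamH L νH g (S_b.filter (fun w => (b w).1 ^ 2 ≠ 4 * (b w).2.1) ∪ T') c = 0) ∧
        ∃ (c₀ : {w : InfinitePlace L // IsComplex w} → Fin 3 → ℝ) (v : ℂ), bzClassMap (S_b.filter (fun w => (b w).1 ^ 2 ≠ 4 * (b w).2.1) ∪ T) c₀ = b ∧
          c₀ ∈ closure (RegS (S_b.filter (fun w => (b w).1 ^ 2 ≠ 4 * (b w).2.1) ∪ T)) ∧ v ≠ 0 ∧
          Tendsto (fun c => stOrbFamH L νH g (S_b.filter (fun w => (b w).1 ^ 2 ≠ 4 * (b w).2.1) ∪ T) c /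
            ∏ w, (if w ∈ S_b.filter (fun w => (b w).1 ^ 2 ≠ 4 * (b w).2.1) ∪ T then (1 : ℂ) else (1 - (Circle.exp (c w 2 - c w 0) : ℂ))))
            (𝓝[RegS (S_b.filter (fun w => (b w).1 ^ 2 ≠ 4 * (b w).2.1) ∪ T)] c₀) (𝓝 v) := by
  intro b S_b c_b hb T hT
  -- the reference chart point of the most compact chart `S₀(b)`: (F2) at `T = ∅`
  obtain ⟨cb, hcb, hcen, -, hsp, hcp⟩ := exists_fibrePoint_wall_bricks b S_b c_b hb ∅ (Finset.empty_subset _)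
  simp only [Finset.union_empty, Finset.notMem_empty, not_false_eq_true, forall_const] at hcb hcen hsp hcp
  refine wallGenerators_of_parts L νH hGsp hGcp (S_b.filter (fun w => (b w).1 ^ 2 ≠ 4 * (b w).2.1))
    (Finset.univ.filter (fun w => (b w).1 ^ 2 = 4 * (b w).2.1)) (fun w hwZ hwS => ?_) cb (fun w hw => hsp w hw)
    (fun w hw₀ hwZ => hcp w hw₀ fun h => hwZ ((mem_filter_central_iff b w).2 h)) (fun w hwZ => ?_) b hcb T hT
  · exact ((mem_filter_not_central_iff b S_b w).1 hwS).2 ((mem_filter_central_iff b w).1 hwZ)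
  · have hc : (b w).1 ^ 2 = 4 * (b w).2.1 := (mem_filter_central_iff b w).1 hwZ
    exact hcen w (fun h => ((mem_filter_not_central_iff b S_b w).1 h).2 hc) hc

end Generators


end Literature.NumberTheory.Rogawski1990

end
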